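import Literature.MathematicalPhysics.QuantumFieldTheory.Balaban1983to89.T4HistoryPeeling
import Literature.MathematicalPhysics.QuantumFieldTheory.Balaban1983to89.T4ScalePairing

/-!
# T4PersistentHistoryCount — node U5c / NE7b (cell `pub-balaban`, T4-DAG §2 U5c, §5 row T4-U5c.NE7b-PROVE-P1*, §6
NE7b): the Peierls / entropy–energy COUNT of persistent large-field histories against the p₀ suppression exponent —
the counting half of NE7b made unconditional and K-uniform, and the survival condition
«p₀(g)/N > 4 log L·(1 + o(1))» made exact

HONEST FRAMING (cell `pub-balaban`, T4-DAG PAGE 1).  The cell's T4 target is the existence AND uniqueness of the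
continuum limit of Bałaban's unit-scale averaged loop expectations on a FIXED finite torus — strictly beyond ultraviolet
stability ([Balaban1989LargeFieldII] Thm 1 p. 355); it is NOT infinite volume, NOT the Yang–Mills mass gap, NOT the Clay
problem, and this module is NOT a proof of NE7b.  NE7b (the persistent-activity weight bound of node U5c) is a NEW
ESTIMATE of the cell, not printed anywhere in [Balaban1989LargeFieldI]/[Balaban1989LargeFieldII] (cell record
`t4/T4-XREAD-U5c.md` V5/V6: no age / persistence / large-deviation statement in print).  The cell decomposes it
(`t4/T4-EST-U5c.md` v1.5.2 §3/§9) into an ANALYTIC half — the single-slot, context-uniform insertion price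
(`T4HistoryPeeling.SlotDom.dom`, last clause; `T4InsertionProfile.PointwiseRatio`; rows E2-rel (a)/(b), NE7b-rem: NOT
PRINTED, NOT attacked here) — and a COUNTING half: the sum over the possible pending histories of a structure and over
the structures' birth data against the banked event credits, whose output is the slot-budget clause `Σ_i x i ≤ S K` of
`SlotDom.dom` with a two-rate budget `S K = C·V·r^{K − j⋆(K) + 1}/(1 − r)` (`T4HistoryPeeling.slotBudget_le`,
`relWeightBound_of_slotDom_twoRate`, `T4MatchingClosure.relWeightBound_of_slotDom_twoRate_log`).  In the tree so far the
counting half is kernel arithmetic over COUNTING HYPOTHESES: `recordSum_le` assumes `hcount` (at most `Γ^k` records with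
`k` events) and `hm` (every record has `≥ m₀` events, from a UNIFORM window `N` via
`T4WeightBudget.card_Icc_le_of_windows`), `slotBudget_le` assumes `hcount` (at most `V·Λ^{K−j₀}` slots born at step
`j₀`).  A uniform window is in tension with the printed flow: the window `R_s` of B14 (2.5) creeps along a long run
(B14 (2.7)/(2.9); `t4/T4-EST-U5E-rem.md` (Y1), `T4ScalePairing` header), so `N := max_s R_s` is cutoff-dependent and
the per-step rate `(Γρ)^{1/N}` of `pow_eventCount_le_twoRate` degenerates as `K → ∞`.

WHAT THIS MODULE PROVES ([folklore] finite combinatorics and real arithmetic; zero `sorry`, zero new cite; imports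
`T4HistoryPeeling` and `T4ScalePairing` BY NAME, modifies nothing):
* §1 AN EXPLICIT RECORD MODEL WITH EVENT-ATTACHED WINDOWS.  Events are elements of an arbitrary type `ε` (in the
  application (step, kind ∈ {renewal, merger, …}, fatness class); mergers ARE events, GAPS G-adv9-60); `W e` is the
  window the banked credit of `e` pays for, `b` the birth event.  A record `Q` (finite set of events) of a structure
  born at step `j` and still pending at the cutoff `K` is charged only through the SPAN CONDITION `SpanLE W j K b Q`:
  `K + 1 − j ≤ W b + Σ_{e ∈ Q} W e`, which `spanLE_of_covers` derives from ANY placed window cover of the life `[j, K]`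
  (typed form of the cell READING (P2) of `T4-EST-U5c` §9 — windows immediate at the event, renewal «K = R_{j+1}»
  p. 386 / epoch «K ≤ n₀ − j + R_j» p. 385, or deferred to the partner's horizon, merger «K ≤ K₂ + n₁ + R_{j+1}»
  p. 387).  This is the VARIABLE-window form of `card_Icc_le_of_windows`, with no uniform `N`; the record space
  `records W j K E b` = subsets of a finite event universe `E` satisfying the span condition (a superset of the
  realisable histories — it only enlarges the bound) is explicit and decidable (§8).
* §2 THE PAIRED RECORD SUM (the cell's PAIRING LEMMA of `T4-EST-U5c` §9 SUMMED OVER ALL RECORDS — "every history/weight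
  sum … NOT PRINTED" there, and not in the tree before).  If the price of record `Q` is at most
  `ρ b · e^{−κ₁ W b} · ∏_{e ∈ Q} (e^{−κ₁ W e} · η e)` (each event's banked credit split as `κ₁ ×` the window it pays
  for, times a residual factor `η e ≥ 0` carrying the event's entropy; the birth factors likewise supply `e^{−κ₁ W b}`
  beyond a birth residual `ρ b`, `Σ_b ρ b ≤ ρ̄` over the birth kinds), then the sum over ALL records is at most
  `ρ̄ · e^{−κ₁ (K + 1 − j)} · ∏_{e ∈ E} (1 + η e)` (`pairedRecordSum_le`, `pairedRecordSum_births_le`; kernel: §1 +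
  Mathlib `Finset.prod_one_add` — records are counted EXACTLY as subsets, no window cap, no event-number floor `m₀`),
  hence `≤ ρ̄ e^{−κ₁} · σ^{K − j}` with the per-step survival rate `σ := e^{η̄ − κ₁}` when the residuals of the events
  AT EACH STEP of `(j, K]` add up to `≤ η̄` (`prod_one_add_le_exp_mul`, `slotPrice_le`).  This is `slotBudget_le`'s
  cost hypothesis `hcost` with `C = ρ̄ e^{−κ₁}`, DERIVED from a per-record price instead of assumed per slot.
* §3 THE BIRTH COUNT AND THE TWO-RATE BUDGET.  Slots = (birth step `j < j⋆`, birth cell `z ∈ Cell (K − j)`) with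
  `#Cell a ≤ V·Λ^a` (`card_torusCells`: the positions of the scale-`j` lattice in a torus of `ℓ^d` unit blocks number
  EXACTLY `ℓ^d · (L^d)^{K − j}`); `oldSlotBudget_le`: the total price of all old slots is
  `≤ ρ̄ e^{−κ₁} · V · (Λσ)^{K − j⋆ + 1}/(1 − Λσ)` whenever `Λσ < 1` — symbol for symbol the budget of
  `T4HistoryPeeling.relWeightBound_of_slotDom_twoRate` (`C := ρ̄ e^{−κ₁}`, `r := Λσ`), via
  `T4WeightBudget.twoRate_majorant_le`; `sum_le_of_injOn_slots` transfers it to ANY consumer indexing `Fin n`/`ι` of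
  slots identified injectively with (birth step, birth cell) — i.e. it DISCHARGES `slotBudget_le`'s `hcount`; and
  `slotDom_of_records` PACKAGES everything into the consumer's carrier: switch-off data + injective birth labelling +
  per-record prices + the single-slot ratio bound with ratio `Σ_b Σ_Q y i b Q` ⇒ `T4HistoryPeeling.SlotDom l₀ T A Bad S`
  with `S K = (ρ̄ e^{−κ₁})·V·(Λσ)^{K − j⋆ K + 1}/(1 − Λσ)` for EVERY cutoff `K` with one set of constants — exactly
  the hypothesis of `relWeightBound_of_slotDom_twoRate` / `T4MatchingClosure.relWeightBound_of_slotDom_twoRate_log`.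
* §4 THE RATE CONDITION.  `twoRate_lt_one_of_margin`: `Λσ < 1` with `Λ = L^d` as soon as `d·log L + η̄ < κ₁`; and
  `pow_four_mul_exp_lt_one_iff`: for `d = 4`, `κ₁ = p/N`, `η̄ = E/N` this is literally
  `0 < T4WeightBudget.survivalRate p E N L` (`exp_entropy_mul_exp_survival_lt_one_iff` by name).
* §5 THE SURVIVAL CONDITION AGAINST THE PRINTED EXPONENT PROFILE — «(1 + o(1))» MADE EXACT, K-UNIFORMLY.
  `credit_dominates_window`: along a run `g 0, …, g K` satisfying the tree's TYPED B14 (2.7) (`B14.FlowIneq27`, first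
  member) with windows tied to the couplings by the TYPED (2.5) (`B14.IsRj`), `r ≤ p₀`, and event windows
  `W s ≤ (1 + F)·R_s` (`F` = the printed O(1) slack: «n₁ < 10» p. 387, the size-dependent part «n₀ − j» p. 385 being
  charged to the residual `η` by the size credit — READING, see below), the single CLOSED-FORM γ-CLAUSE
  `L(1+β₀)·((1+F)κ₁ + E) ≤ c·A₀·(log g_K⁻²)^{p₀ − r}` on the INFRARED coupling `g_K` alone gives, at EVERY scale
  `s ≤ K`, `κ₁·W s + E ≤ c·p₀(g_s)` — the per-event split of §2 with margin `E` (kernel: `T4ScalePairing.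
  kappa_mul_R_le_p0Profile`).  `gammaClause_of_large` / `exists_threshold`: for `p₀ > r` the γ-clause holds for all
  `log g_K⁻² ≥ x₀ := max 1 (L(1+β₀)((1+F)κ₁ + E)/(c A₀))` — the node's «p₀(g)/N > 4 log L·(1 + o(1))» as an
  explicit threshold, automatic over the printed N-window (`t4/T4-XREAD-U5c.md` V1/[A1]: N ≤ R_k, p. 361) and
  uniform in the cutoff.  §6: the numerical instance at the cell's SMALLNESS.md §4.3 witnesses (d = 4, L = 13,
  β₀ = 1/7, p₀ = 23, r₀ = 2, F = 10, c = (2(1+β₀))⁻¹, A₀ = 1, κ₁ = 50 ≥ 4 log 13 + η̄ + 1 with η̄ = 1, any entropy margin E ≤ 10^40,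
  log g_K⁻² = 254): both the γ-clause and the rate condition hold (`norm_num`; `x + 1 < e^x` is the only
  transcendental input).  [v1.1, DOCFIX G-t4r2-1] The witness list carries `p₁ = 21` (SMALLNESS.md §4.3): the renewal
  credit «exp(−p₀(g_j))» is printed (p. 383) under «We assume that 2p₁ − (d+5)r₀ > p₀», i.e. `21 ≤ p₁ < 23` here
  (§10 `exponent_constraints_23`); `p₁` does not enter the γ-clause / rate arithmetic, which is ALL that §6 checks.
* §7 THE UNIFORM-WINDOW SPECIAL CASE: for the kernel's existing route the two counting hypotheses of
  `recordSum_le`/`pow_eventCount_le_twoRate` on the explicit gap-vector records (`card_gapRecordsPending_le`,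
  `window_of_gapRecordPending`).
* §9 [v1.1] THE PRINTED R-POLYNOMIAL CONTROL COST — «for p₀ large and γ small enough» MADE EXACT, K-UNIFORMLY.  The
  uniform entropy margin `E` of §5 cannot absorb print's per-event CONTROL COSTS, which are polynomial in the window
  and grow toward the ultraviolet along the run: the reset «κ_{j+1}(Z) = p₀(g_j) − O(1)M^dR^{d+1}_{j+1}d′_{j+1}(Z)»
  (p. 386), the merger term «+ O(1)3(100M)^dR_{j+1}^{d+2}» of (1.88) (p. 387), and the K-step cost of the inductive
  statement (1.80) (p. 384) summed in (1.81) (p. 385) to «O(1)(64)^dM^dL^{d+1}R_j^{d+2}(d′_j(Z) + 1)»; print absorbs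
  them by «for p₀ large and γ small enough» (p. 387) / «This condition is satisfied for p₀ large, and g₁ sufficiently
  small» (p. 385).  `credit_dominates_window_poly`: under the run hypotheses of §5, the EXPONENT CONDITIONS `r ≤ p₀`,
  `r·q ≤ p₀` (= the cell's SMALLNESS.md (X7) «p₀ > (d+2)r₀» at print's `q = d + 2`, rows S-B16.10/S-B16.11) and a
  SECOND closed-form γ-clause `L^q(1+β₀)E₁ ≤ c₂·A₀·(log g_K⁻²)^{p₀ − rq}` on the infrared coupling alone:
  `κ₁·W s + E₀ + E₁·(R s)^q ≤ (c₁ + c₂)·p₀(g_s)` at EVERY scale `s ≤ K` (kernel: `isRj_pow` — (2.5) is stable under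
  powers, `(L^q, r·q, R^q)` — and the ratio theorem `T4ScalePairing.kappa_mul_R_le_p0Profile` for the powered window);
  `windowCost_le` / `windowCostDecay_le`: with the typed (2.9) first member (`B14FlowStep.FlowIneq29`, «R_n ≤ L R_m»)
  the per-step costs `E₂(R n)^{q'}` resp. `E₃(R n)^{q'}2^{−(n−s)}` summed over the performed steps `n ∈ (s, s + W s]`,
  `n ≤ K`, of a window are `≤ (1+F)L^{q'}E₂(R s)^{q'+1}` resp. `≤ E₃L^{q'}(R s)^{q'}` — the two sums of (1.81), typed;
  `credit_dominates_windowSum` (the (1.80)-shaped statement), `exists_threshold_poly` (ONE infrared threshold `x₀` for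
  both γ-clauses whenever `r·q < p₀`), `survival_package_poly`.  §10: the instance at the §4.3 witnesses — (X6)
  «2p₁ − (d+5)r₀ > p₀» (p. 383) at `p₁ = 21`: `42 − 18 = 24 > 23`, `p₁ < p₀`, (X7) `2·6 = 12 < 23` (`decide`); both
  γ-clauses at `log g_K⁻² = 254`, `c₁ = c₂ = 7/32`, `E₀ = 10^40`, `E₁ = 10^19` (resp. `E₂ = 10^12`, `q' = 5`) by
  `norm_num`.  §6/§10 check ONLY this exponent / γ-clause / rate arithmetic; the exponent `p₁` enters §5/§9 nowhere
  (DOCFIX G-t4r2-1: at the §4.3 witnesses `p₁ = 21`, admissible window `21 ≤ p₁ < 23`).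
* §11 [v1.2] THE BIRTH CREDIT DOMINATES THE SIZE-CARRYING COSTS, FATNESS CLASS BY FATNESS CLASS.  Print gives every
  new component the birth factor «exp(−½γ₀A₁²p₀²(g_j)(d′_j(Z_j^{(i)}) + 1) − 2p₀(g_j))» ((1.79) p. 383) and pays the
  window cost (1.81) out of its quadratic part: «¼γ₀(14)^{−d}A₁²p₀²(g₁) ≥ O(1)2(64)^dM^dL^{d+1}R₁^{d+2}. This
  condition is satisfied for p₀ large, and g₁ sufficiently small.» (p. 385).  `birthCredit_dominates`: if the costs
  PER UNIT OF `d′ + 1` (fat-shape entropy `E_f`, summability margin `μ`, decayed control cost `E_b·(R s)^q` — the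
  first sum of (1.81), `windowCostDecay_le`) are `≤ c₃·p₀(g_s)` at every `s ≤ K` (the conclusion shape of
  `credit_dominates_window_poly` with `κ₁ := 0`) and the infrared threshold `(1+β₀)c₃ ≤ a·p₀(g_K)` holds, then
  `(E_f + μ + E_b(R s)^q)(d′+1) ≤ a·p₀(g_s)²·(d′+1)` at EVERY `s ≤ K` and EVERY fatness `d′` (kernel: (2.7) first
  member as `p0Profile_ir_le`; `p0Profile_sq`: `p₀(x)² = p0Profile A₀² (2p₀) x`); `sum_exp_neg_succ_le`: the residual
  `exp(−μ(d′+1))` sums to `≤ e^{−μ}/(1 − e^{−μ})` over any number of fatness classes — what makes `Σ_b ρ b ≤ ρ̄` of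
  `slotDom_of_records` cutoff- and volume-uniform once birth kinds are fatness classes (READING (ID)).

WHAT IS NOT PROVED HERE (and not printed — cell GAPS.md is the census; rows G-ne7bp1-*):
(E2) the per-record PRICE hypothesis `hy` of §2/§3 — that switching one structure with record `Q` into a good-class
term costs at most `ρ b · e^{−κ₁ W b} ∏_{e∈Q} e^{−κ₁ W e} η e` UNIFORMLY IN THE CONTEXT (other structures, small-field
action, boundary terms): this is the single-slot context-uniform insertion price (rows E2-rel (a)/(b), NE7b-rem; typed
shapes `T4HistoryPeeling.SlotDom.dom`, `T4InsertionProfile.PointwiseRatio` / `PointDom`, `T4JointInsertionProfile`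
§2–§4 for the composite per-event entropy inside `η`), the ANALYTIC heart of NE7b, owned by other rows;
(R1) the banked induction (1.80⁺) — that the printed credits (renewal «exp(−p₀(g_j))» p. 386, merger surplus
«2(1+β₀)^{−1}p₀(g_{j+1})» pp. 386–387, birth factors (1.79) p. 383) may be BANKED per event rather than spent as in the
printed (1.88) (`T4-EST-U5c` §3 (R1), `T4-XREAD-U5c` [A3]);
(ID) the identification of (`ε`, `W`, `κ₁`, `η`, `ρ`, `Cell`) with print's events / windows / credits / entropies /
birth cubes —
the located READING (P1)/(P2) of `T4-EST-U5c` §9 (GAPS C-pv14-43) and R4 of `T4HistoryPeeling`;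
(BetaPertH)/(B)/(B^μ): the run `g` with `B14.FlowIneq27` and `B14.IsRj` is a HYPOTHESIS of §5 (the cell's conditional
(B) enters exactly there, as the existence of the flow; nothing of it is hidden in a definition).

PRINTED CONTEXT (LOCATION ONLY; every «…» was READ BY THIS SEAT AS AN IMAGE on the ×2 renders
`b2b-balaban-ref1/pages/1989-cmp122-large-field-II/1989-cmp122-large-field-II-pNNN-x2.png`, NNN = 031, 032, 033 = journal
pp. 385/386/387 of [Balaban1989LargeFieldII] = T. Bałaban, *Large field renormalization. II*, Commun. Math. Phys. 122
(1989) 355–392; PDF page = journal page − 354).  The three printed WINDOW statements behind `Covers`/`SpanLE`: p. 385 «Thus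
K ≤ n₀ − j + R_j» (epoch from a general start), p. 386 «we have the new factor exp(− p₀(g_j)). We define κ_{j+1}(Z) =
p₀(g_j) − O(1)M^dR_{j+1}^{d+1}d′_{j+1}(Z). It satisfies (1.80), because Z is a small domain, it is contained in a cube
of the size 100MR_{j+1}, hence K = R_{j+1} for Z.» (renewal: credit AND window at the same step), p. 387 «e.g., n₁ < 10,
… and that K ≤ K₂ + n₁ + R_{j+1}.» (merger) with the surplus p. 386 «2p₀(g_{j(X)}) + 2p₀(g_{j(Y)}) − 2p₀(g_{j(Z)}) ≥
2(1 + β₀)^{−1}p₀(g_{j+1}).» and (1.88) p. 387 «≤ κ_{j+1}(Z) − 2(1 + β₀)^{−1}p₀(g_{j+1}) + O(1)3(100M)^dR_{j+1}^{d+2} ≤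
κ_{j+1}(Z), (1.88) for p₀ large and γ small enough.» (the surplus DISCARDED in print).  The remaining loci (p. 361
«N ≤ R_k», p. 383 (1.79) and «exp O(1)(MR_j)^{−d}|Z_j|», p. 384 (1.80)) are cited from the cell's certified reading
`t4/T4-XREAD-U5c.md` (Q1), (Q11), (Q12) (renders read there, GAPS C-pv05g5-1) and are NOT re-quoted.  B14 (2.5)/(2.7)
enter only through the tree's typed displays `B14.IsRj` / `B14.FlowIneq27` ([Balaban1988Convergent] p. 255, cited
there).  Print performs no history or weight sum; nothing below is attributed to Bałaban.
Unit `b2b-balaban-t4-ne7b-p1` (planner; journal CLAIM T4-U5c.NE7b-PROVE-P1* 2026-08-19T06:45:50Z; record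
`t4/T4-EST-NE7b-P1.md`).  Value = kernel bookkeeping + the exact survival inequality, NOT summit progress.

v1.1 (gen 2 of the same unit, journal l.47722, 2026-08-19): APPEND-ONLY §9–§10 (the printed R-polynomial control cost,
11 declarations) + the DOCFIX G-t4r2-1 sentences in this header and in §6; every v1 declaration is unchanged.  Printed
context added, READ BY THIS SEAT AS IMAGES (renders p029, p030, p031 = pp. 383, 384, 385): p. 383 «We assume that
2p₁ − (d+5)r₀ > p₀, and we estimate the factors by exp(− p₀(g_j))»; p. 384 «The factor exp(− κ_j(Z)) controls K
renormalization steps, under the assumption that no large fields are created in these steps, … with N = R_j. More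
precisely this means that κ_j(Z) ≥ Σ_{n=j+1}^{j+K} O(1)M^dR_n^{d+1}d′_n(S^{n−j}(Z)). (1.80)», «d′_n(S^{n−j}(Z)) ≤ (64)^d if
it is equal to 0» (the linear size), «d′_n(Z^{(n−j)}) ≤ L^{−1/2(n−j)}d′_j(Z) ≤ 2^{−(n−j)}d′_j(Z)»; p. 385 «Thus
K ≤ n₀ − j + R_j, and we have Σ_{n=j+1}^{j+K} O(1)M^dR_n^{d+1}d′_n(S^{n−j}(Z)) ≤ Σ_{n=j+1}^{n₀} O(1)M^dR_n^{d+1}3(126)^d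
2^{−(n−j)}d′_j(Z) + Σ_{n=n₀+1}^{n₀+R_j} O(1)M^ddR_n^{d+1}(64)^d ≤ O(1)3(126)^dM^dL^{d+1}R_j^{d+1}d′_j(Z) +
O(1)(64)^dM^dL^{d+1}R_j^{d+2} ≤ O(1)(64)^dM^dL^{d+1}R_j^{d+2}(d′_j(Z) + 1). (1.81)» and «¼γ₀(14)^{−d}A₁²p₀²(g₁) ≥
O(1)2(64)^dM^dL^{d+1}R₁^{d+2}. This condition is satisfied for p₀ large, and g₁ sufficiently small.»  §9 types the
absorption step only; which event carries which cost, and the size-dependent first sum of (1.81) against the p₀²-type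
birth factors of (1.79)/(1.82), remain READING (ID) as in v1.  Nothing in §9–§10 is attributed to Bałaban beyond these
quotations; the O(1), M-dependent constants stay symbolic (`E₀`, `E₁`, `E₂`, `E₃`).

v1.2 (gen 2, same unit, 2026-08-19): APPEND-ONLY §11 (4 declarations: `p0Profile_ir_le`, `birthCredit_dominates`,
`p0Profile_sq`, `sum_exp_neg_succ_le`); every v1/v1.1 declaration is unchanged; no new quotation (the two «…» of §11
are the (1.79) birth factor of p. 383 and the p. 385 condition sentence already quoted above, both READ BY THIS SEAT AS
IMAGES on renders p029/p031).  §11 types the domination inequality only; that its left side is what a birth of fatness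
`d′` costs, and the residual's identification with the birth kind's price `ρ b`, remain READING (ID).  Print's exponent
need at the birth is `2p₀ ≥ (d+2)r₀`; routed through §9 the typed form uses the cell's stronger (X7) `r₀(d+2) ≤ p₀`.

v1.3 (gen 3, same lineage, 2026-08-19): DOCSTRING-ONLY fold of the cross-read advisories C-pv18g12-1 (D1: two docstrings of
§9 carried ADAPTED text inside guillemets — replaced by the verbatim displays of pp. 384/386 or marked as adapted; D2: the
printed qualifier «for n − j > 1» of the `2^{−(n−j)}` decay recorded at `windowCostDecay_le` — it is also BOOKED as the
`max 1` of `T4PersistenceDictionary.fatWait`; I1: at the cell's SMALLNESS §4.3 witnesses the admissible `p₁` is exactly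
the named witness `21`, information only).  No declaration, statement or proof changed (byte-identical code).

v1.4 (gen 6, same lineage, 2026-08-19; unit b2b-balaban-t4-ne7b-p1 gen 6): APPEND-ONLY §12 «THE ALL-AGES CONTEXT COUNT
DIVERGES WITH THE CUTOFF» (4 declarations: `p0Profile_age_le`, `pow_mul_exp_neg_rpow_tendsto_atTop`,
`allAges_birthBudget_unbounded`, `birthCredit_flowShape`); every v1–v1.3 declaration unchanged; no new quotation (the only
printed input is the typed second member of (2.7), `B14.FlowIneq27`, already this file's hypothesis `h27`).  THE NECESSITY
SIDE OF THE NODE's BOOKKEEPING [analysis + folklore; nothing of Bałaban's asserted]: read along AGES from the final step,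
(2.7) lets the birth credit of a component born `a` steps earlier exceed the final one by at most the POWER
`(1 + g_K² β′ a)^{β₀}` of the age (`p0Profile_age_le`; under U5a's coupling window `p₀(g_{K−a}) ≤ C (1 + c a)^{β₀}`,
`birthCredit_flowShape`), while the torus offers `V·Λ^a` cells per age (`Λ = L^d`); since `Λ^a e^{−C(1+ca)^{β₀}} → ∞`
(`pow_mul_exp_neg_rpow_tendsto_atTop`, `β₀ < 1`), the BIRTH-ONLY budget over ALL ages `Σ_{a ≤ K} V Λ^a e^{−P K a}` is
UNBOUNDED in the cutoff `K` (`allAges_birthBudget_unbounded`).  Consequences for the cell's bookkeeping (records only):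
(i) no ABSOLUTE count of large-field components over all scales is K-uniform, even at fixed volume — K-uniform context
budgets must run over the LIVE index set (ages within the window: `credit_dominates_window` here,
`T4BadClassBooking.AgeCover` with `a ≤ N`; older regions are print's RESUMMED ones, B16 p. 383 «Finally, the summations over
the admissible sequences can be replaced by the factors exp O(1)(MR_j)^{−d}∣Z_j∣.», quoted above), and (ii) summability in
`K` comes from PERSISTENCE — renewal credit LINEAR in the age, `slotDom_of_records` — never from births.  Addressed to the
renewal member's «global-denominator re-typing» (t4-ne7b-p2 gen 6, journal 2026-08-19T12:35:18Z): its entropy input (G4) must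
be a sum over live histories (old part = this file's records sum, young context = the window budget), not over all past
regions.  Cell analysis; no manuscript step affected; NOT summit progress.
-/

open Finset

namespace Literature.MathematicalPhysics.QuantumFieldTheory.Balaban1983to89.T4PersistentHistoryCount

open Literature.MathematicalPhysics.QuantumFieldTheory.Balaban1983to89
open T4WeightBudget T4HistoryPeeling T4ScalePairing

/-! ## §1 Records with event-attached windows: the span condition and the window cover -/

section Records

variable {ε : Type*}

/-- **THE SPAN CONDITION** of a record.  Events are elements of an arbitrary type `ε` ((step, kind, fatness class, …) in
the application); `W e` is the window (in steps) that the banked credit of event `e` pays for; `b` is the birth event of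
the structure (its window `W b` paid by the birth factors).  A record `Q` (finite set of events) of a structure born at
step `j` and still pending at the cutoff step `K` satisfies the span condition iff the windows add up to at least the
life span: `K + 1 − j ≤ W b + Σ_{e ∈ Q} W e`.  This is the ONLY property of a pending history the count uses; it is
implied by every printed window statement however the windows are PLACED (`spanLE_of_covers`): immediately at the event
(renewal «K = R_{j+1}» p. 386, epoch «K ≤ n₀ − j + R_j» p. 385) or deferred to the partner's horizon (merger
«K ≤ K₂ + n₁ + R_{j+1}» p. 387). [folklore] -/
def SpanLE (W : ε → ℕ) (j K : ℕ) (b : ε) (Q : Finset ε) : Prop :=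
  K + 1 - j ≤ W b + ∑ e ∈ Q, W e

/-- The span condition is decidable (an inequality of naturals). [folklore] -/
instance SpanLE.instDecidable (W : ε → ℕ) (j K : ℕ) (b : ε) (Q : Finset ε) : Decidable (SpanLE W j K b Q) := by
  unfold SpanLE; infer_instance

/-- **PLACED WINDOW COVER**: the windows `[a e, a e + W e)` of the birth and of the events, placed at arbitrary starts
`a e`, cover the life `[j, K]` (typed READING (P2) of `t4/T4-EST-U5c.md` §9: from every epoch start the structure is
renormalised within the window unless an event intervenes; placement immediate or deferred). [folklore] -/
def Covers [DecidableEq ε] (W : ε → ℕ) (j K : ℕ) (b : ε) (Q : Finset ε) (a : ε → ℕ) : Prop :=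
  ∀ x ∈ Icc j K, ∃ e ∈ insert b Q, a e ≤ x ∧ x < a e + W e

/-- A placed cover is decidable. [folklore] -/
instance Covers.instDecidable [DecidableEq ε] (W : ε → ℕ) (j K : ℕ) (b : ε) (Q : Finset ε) (a : ε → ℕ) :
    Decidable (Covers W j K b Q a) := by
  unfold Covers; infer_instance

/-- **THE WINDOW COVER ⇒ THE SPAN CONDITION** (variable, event-attached windows; `T4WeightBudget.card_Icc_le_of_windows`
is the uniform-window case `W ≡ N`, which there yields an event-number floor `m₀` — here no floor and no uniform `N` are
needed). [folklore] -/
theorem spanLE_of_covers [DecidableEq ε] {W : ε → ℕ} {j K : ℕ} {b : ε} {Q : Finset ε} {a : ε → ℕ}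
    (h : Covers W j K b Q a) (hb : b ∉ Q) : SpanLE W j K b Q := by
  have hsub : Icc j K ⊆ (insert b Q).biUnion (fun e => Ico (a e) (a e + W e)) := by
    intro x hx
    rw [Finset.mem_biUnion]
    obtain ⟨e, he, h1, h2⟩ := h x hx
    exact ⟨e, he, Finset.mem_Ico.2 ⟨h1, h2⟩⟩
  unfold SpanLE
  calc K + 1 - j = (Icc j K).card := (Nat.card_Icc j K).symm
    _ ≤ ((insert b Q).biUnion fun e => Ico (a e) (a e + W e)).card := Finset.card_le_card hsub
    _ ≤ ∑ e ∈ insert b Q, (Ico (a e) (a e + W e)).card := Finset.card_biUnion_le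
    _ = ∑ e ∈ insert b Q, W e := Finset.sum_congr rfl fun e _ => by rw [Nat.card_Ico, add_tsub_cancel_left]
    _ = W b + ∑ e ∈ Q, W e := Finset.sum_insert hb

/-- Events as (step, mark) pairs with IMMEDIATE placement (window of `(s, k)` = `[s, s + W (s, k))`): the decidable
special case used in the sanity checks (renewal / epoch windows). [folklore] -/
def Admissible (W : ℕ × ℕ → ℕ) (j K : ℕ) (b : ℕ × ℕ) (Q : Finset (ℕ × ℕ)) : Prop :=
  ∀ x ∈ Icc j K, ∃ e ∈ insert b Q, e.1 ≤ x ∧ x < e.1 + W e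

/-- Admissibility is decidable (a bounded `∀∃` over finsets). [folklore] -/
instance Admissible.instDecidable (W : ℕ × ℕ → ℕ) (j K : ℕ) (b : ℕ × ℕ) (Q : Finset (ℕ × ℕ)) :
    Decidable (Admissible W j K b Q) := by
  unfold Admissible; infer_instance

/-- Immediate placement is a placed cover. [folklore] -/
theorem covers_of_admissible {W : ℕ × ℕ → ℕ} {j K : ℕ} {b : ℕ × ℕ} {Q : Finset (ℕ × ℕ)}
    (h : Admissible W j K b Q) : Covers W j K b Q Prod.fst := h

/-- **THE RECORDS** of a structure born at `j`, pending at `K`, with birth event `b`, drawn from a finite EVENT UNIVERSE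
`E` (in the application: (step `∈ (j, K]`) × (kind / fatness class)): the subsets of `E` satisfying the span condition —
a SUPERSET of the geometrically realisable histories, which only enlarges the bound. [folklore] -/
def records (W : ε → ℕ) (j K : ℕ) (E : Finset ε) (b : ε) : Finset (Finset ε) :=
  E.powerset.filter (SpanLE W j K b)

/-- Membership in `records`. [folklore] -/
theorem mem_records {W : ε → ℕ} {j K : ℕ} {E : Finset ε} {b : ε} {Q : Finset ε} :
    Q ∈ records W j K E b ↔ Q ⊆ E ∧ SpanLE W j K b Q := by
  simp [records]

/-- **THE PAIRED FACTOR OF ONE RECORD** (`T4ScalePairing.exp_neg_le_sigma_pow` is the abstract `σ^{span}` price; this is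
its record-level form): with `κ₁ ≥ 0`, under the span condition the window parts of the birth credit and of the event
credits multiply to at most `e^{−κ₁ (K + 1 − j)}`. [folklore] -/
theorem pairedFactor_le {W : ε → ℕ} {j K : ℕ} {b : ε} {Q : Finset ε} {κ₁ : ℝ} (hκ : 0 ≤ κ₁)
    (hQ : SpanLE W j K b Q) :
    Real.exp (-(κ₁ * W b)) * ∏ e ∈ Q, Real.exp (-(κ₁ * W e)) ≤ Real.exp (-(κ₁ * ((K + 1 - j : ℕ) : ℝ))) := by
  rw [← Real.exp_sum, ← Real.exp_add]
  apply Real.exp_le_exp.2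
  have h : ((K + 1 - j : ℕ) : ℝ) ≤ (W b : ℝ) + ∑ e ∈ Q, (W e : ℝ) := by exact_mod_cast hQ
  have hsum : -(κ₁ * (W b : ℝ)) + ∑ e ∈ Q, -(κ₁ * (W e : ℝ)) = -(κ₁ * ((W b : ℝ) + ∑ e ∈ Q, (W e : ℝ))) := by
    rw [Finset.sum_neg_distrib, ← Finset.mul_sum]; ring
  rw [hsum]
  exact neg_le_neg (mul_le_mul_of_nonneg_left h hκ)

end Records

/-! ## §2 The paired record sum: all records at once, no window cap, no event-number floor -/

section PairedSum

variable {ε : Type*}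

/-- **THE PAIRED RECORD SUM** (the PAIRING LEMMA of `t4/T4-EST-U5c.md` §9 summed over every record; the counting heart of
this module).  Price hypothesis `hy` (= the ANALYTIC input E2 ∧ R1, NOT proved here): the price of record `Q` is at
most `ρ · e^{−κ₁ W b} · ∏_{e ∈ Q} (e^{−κ₁ W e} · η e)` — birth residual `ρ ≥ 0`, each event credit split into `κ₁ ×`
the window it pays for and a residual factor `η e ≥ 0` (the entropy of the event's kind / position / shape / fatness
included).  Then `Σ_{Q ∈ records} y Q ≤ ρ · e^{−κ₁ (K + 1 − j)} · ∏_{e ∈ E} (1 + η e)`: the records are counted EXACTLY as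
subsets of the event universe (Mathlib `Finset.prod_one_add`), the windows telescope by §1. [folklore] -/
theorem pairedRecordSum_le (W : ε → ℕ) (j K : ℕ) (E : Finset ε) (b : ε) {κ₁ ρ : ℝ} (hκ : 0 ≤ κ₁) (hρ : 0 ≤ ρ)
    (η : ε → ℝ) (hη : ∀ e ∈ E, 0 ≤ η e) (y : Finset ε → ℝ)
    (hy : ∀ Q ∈ records W j K E b,
      y Q ≤ ρ * Real.exp (-(κ₁ * W b)) * ∏ e ∈ Q, (Real.exp (-(κ₁ * W e)) * η e)) :
    ∑ Q ∈ records W j K E b, y Q ≤ ρ * Real.exp (-(κ₁ * ((K + 1 - j : ℕ) : ℝ))) * ∏ e ∈ E, (1 + η e) := by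
  have hstep : ∀ Q ∈ records W j K E b,
      y Q ≤ ρ * Real.exp (-(κ₁ * ((K + 1 - j : ℕ) : ℝ))) * ∏ e ∈ Q, η e := by
    intro Q hQ
    have hQ' := mem_records.1 hQ
    have hη' : 0 ≤ ∏ e ∈ Q, η e := Finset.prod_nonneg fun e he => hη e (hQ'.1 he)
    calc y Q ≤ ρ * Real.exp (-(κ₁ * W b)) * ∏ e ∈ Q, (Real.exp (-(κ₁ * W e)) * η e) := hy Q hQ
      _ = ρ * (Real.exp (-(κ₁ * W b)) * ∏ e ∈ Q, Real.exp (-(κ₁ * W e))) * ∏ e ∈ Q, η e := by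
          rw [Finset.prod_mul_distrib]; ring
      _ ≤ ρ * Real.exp (-(κ₁ * ((K + 1 - j : ℕ) : ℝ))) * ∏ e ∈ Q, η e :=
          mul_le_mul_of_nonneg_right (mul_le_mul_of_nonneg_left (pairedFactor_le hκ hQ'.2) hρ) hη'
  have h0 : 0 ≤ ρ * Real.exp (-(κ₁ * ((K + 1 - j : ℕ) : ℝ))) := mul_nonneg hρ (Real.exp_pos _).le
  calc ∑ Q ∈ records W j K E b, y Q
      ≤ ∑ Q ∈ records W j K E b, ρ * Real.exp (-(κ₁ * ((K + 1 - j : ℕ) : ℝ))) * ∏ e ∈ Q, η e :=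
        Finset.sum_le_sum hstep
    _ ≤ ∑ Q ∈ E.powerset, ρ * Real.exp (-(κ₁ * ((K + 1 - j : ℕ) : ℝ))) * ∏ e ∈ Q, η e :=
        Finset.sum_le_sum_of_subset_of_nonneg (Finset.filter_subset _ _) fun Q hQ _ =>
          mul_nonneg h0 (Finset.prod_nonneg fun e he => hη e (Finset.mem_powerset.1 hQ he))
    _ = ρ * Real.exp (-(κ₁ * ((K + 1 - j : ℕ) : ℝ))) * ∑ Q ∈ E.powerset, ∏ e ∈ Q, η e := by
        rw [Finset.mul_sum]
    _ = ρ * Real.exp (-(κ₁ * ((K + 1 - j : ℕ) : ℝ))) * ∏ e ∈ E, (1 + η e) := by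
        rw [Finset.prod_one_add]

/-- **… SUMMED OVER THE BIRTH KINDS** `b ∈ B` (birth fatness / shape classes, each with its own window `W b` and residual
`ρ b ≥ 0`, `Σ_{b ∈ B} ρ b ≤ ρ̄`): `Σ_b Σ_{Q ∈ records … b} y b Q ≤ ρ̄ · e^{−κ₁ (K + 1 − j)} · ∏_{e ∈ E} (1 + η e)`. [folklore] -/
theorem pairedRecordSum_births_le (W : ε → ℕ) (j K : ℕ) (E B : Finset ε) {κ₁ ρbar : ℝ} (hκ : 0 ≤ κ₁)
    (ρ : ε → ℝ) (hρ : ∀ b ∈ B, 0 ≤ ρ b) (hρbar : ∑ b ∈ B, ρ b ≤ ρbar) (η : ε → ℝ) (hη : ∀ e ∈ E, 0 ≤ η e)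
    (y : ε → Finset ε → ℝ)
    (hy : ∀ b ∈ B, ∀ Q ∈ records W j K E b,
      y b Q ≤ ρ b * Real.exp (-(κ₁ * W b)) * ∏ e ∈ Q, (Real.exp (-(κ₁ * W e)) * η e)) :
    ∑ b ∈ B, ∑ Q ∈ records W j K E b, y b Q ≤
      ρbar * Real.exp (-(κ₁ * ((K + 1 - j : ℕ) : ℝ))) * ∏ e ∈ E, (1 + η e) := by
  have hP : 0 ≤ Real.exp (-(κ₁ * ((K + 1 - j : ℕ) : ℝ))) * ∏ e ∈ E, (1 + η e) :=
    mul_nonneg (Real.exp_pos _).le (Finset.prod_nonneg fun e he => by linarith [hη e he])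
  calc ∑ b ∈ B, ∑ Q ∈ records W j K E b, y b Q
      ≤ ∑ b ∈ B, ρ b * Real.exp (-(κ₁ * ((K + 1 - j : ℕ) : ℝ))) * ∏ e ∈ E, (1 + η e) :=
        Finset.sum_le_sum fun b hb => pairedRecordSum_le W j K E b hκ (hρ b hb) η hη (y b) (hy b hb)
    _ = (∑ b ∈ B, ρ b) * (Real.exp (-(κ₁ * ((K + 1 - j : ℕ) : ℝ))) * ∏ e ∈ E, (1 + η e)) := by
        rw [Finset.sum_mul]; exact Finset.sum_congr rfl fun b _ => by ring
    _ ≤ ρbar * (Real.exp (-(κ₁ * ((K + 1 - j : ℕ) : ℝ))) * ∏ e ∈ E, (1 + η e)) :=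
        mul_le_mul_of_nonneg_right hρbar hP
    _ = ρbar * Real.exp (-(κ₁ * ((K + 1 - j : ℕ) : ℝ))) * ∏ e ∈ E, (1 + η e) := by ring

/-- `∏_{e ∈ E} (1 + η e) ≤ exp (Σ_{e ∈ E} η e)` for `η ≥ 0` on `E`. [folklore] -/
theorem prod_one_add_le_exp_sum {E : Finset ε} {η : ε → ℝ} (hη : ∀ e ∈ E, 0 ≤ η e) :
    ∏ e ∈ E, (1 + η e) ≤ Real.exp (∑ e ∈ E, η e) := by
  rw [Real.exp_sum]
  exact Finset.prod_le_prod (fun e he => by linarith [hη e he]) fun e _ => by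
    linarith [Real.add_one_le_exp (η e)]

/-- **PER-STEP RESIDUAL ENTROPY**: if every event of the universe `E` happens at a step of `(j, K]` (`step e ∈ Ioc j K`)
and the residuals of the events AT EACH STEP add up to at most `η̄` (all kinds / fatness classes together), then
`∏_{e ∈ E} (1 + η e) ≤ e^{η̄ (K − j)}`. [folklore] -/
theorem prod_one_add_le_exp_mul [DecidableEq ε] {E : Finset ε} (step : ε → ℕ) {j K : ℕ}
    (hE : ∀ e ∈ E, step e ∈ Ioc j K) {η : ε → ℝ} {ηbar : ℝ} (hη : ∀ e ∈ E, 0 ≤ η e)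
    (hηbar : ∀ t ∈ Ioc j K, ∑ e ∈ E with step e = t, η e ≤ ηbar) :
    ∏ e ∈ E, (1 + η e) ≤ Real.exp (ηbar * ((K - j : ℕ) : ℝ)) := by
  refine (prod_one_add_le_exp_sum hη).trans (Real.exp_le_exp.2 ?_)
  rw [← Finset.sum_fiberwise_of_maps_to (g := step) hE]
  calc ∑ t ∈ Ioc j K, ∑ e ∈ E with step e = t, η e ≤ ∑ _t ∈ Ioc j K, ηbar := Finset.sum_le_sum hηbar
    _ = ηbar * ((K - j : ℕ) : ℝ) := by rw [Finset.sum_const, Nat.card_Ioc, nsmul_eq_mul, mul_comm]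

/-- `e^{−κ₁ (K + 1 − j)} · e^{η̄ (K − j)} = e^{−κ₁} · (e^{η̄ − κ₁})^{K − j}` for `j ≤ K`. [folklore] -/
theorem exp_span_mul_exp_eq {κ₁ ηbar : ℝ} {j K : ℕ} (hjK : j ≤ K) :
    Real.exp (-(κ₁ * ((K + 1 - j : ℕ) : ℝ))) * Real.exp (ηbar * ((K - j : ℕ) : ℝ)) =
      Real.exp (-κ₁) * Real.exp (ηbar - κ₁) ^ (K - j) := by
  have h : ((K + 1 - j : ℕ) : ℝ) = ((K - j : ℕ) : ℝ) + 1 := by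
    rw [Nat.sub_add_comm hjK]; push_cast; ring
  rw [h, ← Real.exp_nat_mul, ← Real.exp_add, ← Real.exp_add]
  congr 1; ring

/-- **ONE SLOT'S PRICE IN THE TWO-RATE SHAPE** (`T4HistoryPeeling.slotBudget_le`'s `hcost`, DERIVED): under the price
hypothesis of `pairedRecordSum_births_le` over an event universe living on the steps `(j, K]` with per-step residual
entropy `≤ η̄`, the total price of the slot is `≤ (ρ̄ e^{−κ₁}) · σ^{K − j}` with the PER-STEP SURVIVAL RATE
`σ := e^{η̄ − κ₁}` — `κ₁` per step of age paid by the paired windows, `η̄` per step lost to the exact event count. [folklore] -/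
theorem slotPrice_le [DecidableEq ε] (W : ε → ℕ) {j K : ℕ} (hjK : j ≤ K) (E B : Finset ε) (step : ε → ℕ)
    (hE : ∀ e ∈ E, step e ∈ Ioc j K) {κ₁ ρbar ηbar : ℝ} (hκ : 0 ≤ κ₁) (ρ : ε → ℝ) (hρ : ∀ b ∈ B, 0 ≤ ρ b)
    (hρbar : ∑ b ∈ B, ρ b ≤ ρbar) (η : ε → ℝ) (hη : ∀ e ∈ E, 0 ≤ η e)
    (hηbar : ∀ t ∈ Ioc j K, ∑ e ∈ E with step e = t, η e ≤ ηbar) (y : ε → Finset ε → ℝ)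
    (hy : ∀ b ∈ B, ∀ Q ∈ records W j K E b,
      y b Q ≤ ρ b * Real.exp (-(κ₁ * W b)) * ∏ e ∈ Q, (Real.exp (-(κ₁ * W e)) * η e)) :
    ∑ b ∈ B, ∑ Q ∈ records W j K E b, y b Q ≤ ρbar * Real.exp (-κ₁) * Real.exp (ηbar - κ₁) ^ (K - j) := by
  have h1 := pairedRecordSum_births_le W j K E B hκ ρ hρ hρbar η hη y hy
  have h2 := prod_one_add_le_exp_mul step hE hη hηbar
  have hρbar0 : 0 ≤ ρbar := le_trans (Finset.sum_nonneg hρ) hρbar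
  have h0 : 0 ≤ ρbar * Real.exp (-(κ₁ * ((K + 1 - j : ℕ) : ℝ))) := mul_nonneg hρbar0 (Real.exp_pos _).le
  calc ∑ b ∈ B, ∑ Q ∈ records W j K E b, y b Q
      ≤ ρbar * Real.exp (-(κ₁ * ((K + 1 - j : ℕ) : ℝ))) * Real.exp (ηbar * ((K - j : ℕ) : ℝ)) :=
        h1.trans (mul_le_mul_of_nonneg_left h2 h0)
    _ = ρbar * Real.exp (-κ₁) * Real.exp (ηbar - κ₁) ^ (K - j) := by
        rw [mul_assoc, exp_span_mul_exp_eq hjK, ← mul_assoc]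

end PairedSum

/-! ## §3 The birth count and the two-rate budget -/

section Budget

/-- **THE BIRTH-POSITION COUNT** (model of R4: the anchor cell of a structure born at step `j` of a run of `K` steps is
a point of the scale-`j` lattice, spacing `L^{−(K−j)}` in units of the final lattice, inside a torus of `ℓ^d` unit
blocks): there are EXACTLY `ℓ^d · (L^d)^{a}` such positions at age `a = K − j`. [folklore] -/
theorem card_torusCells (d ℓ L a : ℕ) : Fintype.card (Fin d → Fin (ℓ * L ^ a)) = ℓ ^ d * (L ^ d) ^ a := by
  rw [Fintype.card_fun, Fintype.card_fin, Fintype.card_fin, mul_pow, ← pow_mul, ← pow_mul, Nat.mul_comm a d]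

/-- Real-cast form of the birth-position count, in the shape `V · Λ^a` of `T4HistoryPeeling.slotBudget_le`'s `hcount`
(`V = ℓ^d`, `Λ = L^d`). [folklore] -/
theorem card_torusCells_real (d ℓ L a : ℕ) :
    (Fintype.card (Fin d → Fin (ℓ * L ^ a)) : ℝ) = (ℓ : ℝ) ^ d * ((L : ℝ) ^ d) ^ a := by
  rw [card_torusCells]; push_cast; ring

/-- **MODEL SLOT BUDGET** over explicit slots (birth step `j < j⋆ ≤ K`, birth cell `z ∈ Cell (K − j)`, `#Cell a ≤ V·Λ^a`)
with per-slot prices `X j z ≤ C·σ^{K − j}`: `Σ_{j < j⋆} Σ_{z} X j z ≤ C·V·(Λσ)^{K − j⋆ + 1}/(1 − Λσ)` when `Λσ < 1`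
(`T4WeightBudget.twoRate_majorant_le`).  Same conclusion as `T4HistoryPeeling.slotBudget_le`, with its `hcount`
replaced by the cell family. [folklore] -/
theorem slotBudget_model {γ : Type*} (Cell : ℕ → Finset γ) {V Λ C σ : ℝ} (hV : 0 ≤ V) (hΛ : 0 ≤ Λ) (hC : 0 ≤ C)
    (hσ : 0 ≤ σ) (hr : Λ * σ < 1) (hcell : ∀ a, ((Cell a).card : ℝ) ≤ V * Λ ^ a) {jstar K : ℕ} (hj : jstar ≤ K)
    (X : ℕ → γ → ℝ) (hX : ∀ j < jstar, ∀ z ∈ Cell (K - j), X j z ≤ C * σ ^ (K - j)) :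
    ∑ j ∈ range jstar, ∑ z ∈ Cell (K - j), X j z ≤ C * V * ((Λ * σ) ^ (K - jstar + 1) / (1 - Λ * σ)) := by
  have hinner : ∀ j ∈ range jstar, ∑ z ∈ Cell (K - j), X j z ≤ C * (V * (Λ ^ (K - j) * σ ^ (K - j))) := by
    intro j hj'
    have hjlt := Finset.mem_range.1 hj'
    calc ∑ z ∈ Cell (K - j), X j z ≤ ∑ _z ∈ Cell (K - j), C * σ ^ (K - j) :=
          Finset.sum_le_sum fun z hz => hX j hjlt z hz
      _ = ((Cell (K - j)).card : ℝ) * (C * σ ^ (K - j)) := by rw [Finset.sum_const, nsmul_eq_mul]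
      _ ≤ V * Λ ^ (K - j) * (C * σ ^ (K - j)) :=
          mul_le_mul_of_nonneg_right (hcell (K - j)) (mul_nonneg hC (pow_nonneg hσ _))
      _ = C * (V * (Λ ^ (K - j) * σ ^ (K - j))) := by ring
  calc ∑ j ∈ range jstar, ∑ z ∈ Cell (K - j), X j z
      ≤ ∑ j ∈ range jstar, C * (V * (Λ ^ (K - j) * σ ^ (K - j))) := Finset.sum_le_sum hinner
    _ = C * (V * ∑ j ∈ range jstar, Λ ^ (K - j) * σ ^ (K - j)) := by rw [Finset.mul_sum, Finset.mul_sum]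
    _ ≤ C * (V * ((Λ * σ) ^ (K - jstar + 1) / (1 - Λ * σ))) :=
        mul_le_mul_of_nonneg_left (twoRate_majorant_le hV hΛ hσ hr hj) hC
    _ = C * V * ((Λ * σ) ^ (K - jstar + 1) / (1 - Λ * σ)) := by ring

/-- **TRANSFER TO ANY SLOT INDEXING** (discharge of `T4HistoryPeeling.slotBudget_le`'s `hcount`): if a consumer's slots
`slots : Finset ι` carry a birth step `birth i < j⋆` and a birth cell `cell i ∈ Cell (K − birth i)` with
`i ↦ (birth i, cell i)` INJECTIVE on `slots` (distinct pending structures have distinct birth data), and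
`x i ≤ X (birth i) (cell i)` with `X ≥ 0` on the model slots, then `Σ_{i ∈ slots} x i ≤ Σ_{j < j⋆} Σ_{z ∈ Cell (K − j)} X j z`.
[folklore] -/
theorem sum_le_of_injOn_slots {ι γ : Type*} [DecidableEq γ] (slots : Finset ι) (birth : ι → ℕ) (cell : ι → γ)
    (Cell : ℕ → Finset γ) {jstar K : ℕ} (hold : ∀ i ∈ slots, birth i < jstar)
    (hmem : ∀ i ∈ slots, cell i ∈ Cell (K - birth i))
    (hinj : Set.InjOn (fun i => (⟨birth i, cell i⟩ : Σ _ : ℕ, γ)) slots) (x : ι → ℝ) (X : ℕ → γ → ℝ)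
    (hxX : ∀ i ∈ slots, x i ≤ X (birth i) (cell i)) (hX0 : ∀ j < jstar, ∀ z ∈ Cell (K - j), 0 ≤ X j z) :
    ∑ i ∈ slots, x i ≤ ∑ j ∈ range jstar, ∑ z ∈ Cell (K - j), X j z := by
  classical
  have himg : slots.image (fun i => (⟨birth i, cell i⟩ : Σ _ : ℕ, γ)) ⊆ (range jstar).sigma fun j => Cell (K - j) := by
    intro p hp
    obtain ⟨i, hi, rfl⟩ := Finset.mem_image.1 hp
    exact Finset.mem_sigma.2 ⟨Finset.mem_range.2 (hold i hi), hmem i hi⟩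
  calc ∑ i ∈ slots, x i ≤ ∑ i ∈ slots, X (birth i) (cell i) := Finset.sum_le_sum hxX
    _ = ∑ p ∈ slots.image (fun i => (⟨birth i, cell i⟩ : Σ _ : ℕ, γ)), X p.1 p.2 :=
        (Finset.sum_image (f := fun p : Σ _ : ℕ, γ => X p.1 p.2) hinj).symm
    _ ≤ ∑ p ∈ (range jstar).sigma (fun j => Cell (K - j)), X p.1 p.2 :=
        Finset.sum_le_sum_of_subset_of_nonneg himg fun p hp _ => by
          obtain ⟨h1, h2⟩ := Finset.mem_sigma.1 hp
          exact hX0 p.1 (Finset.mem_range.1 h1) p.2 h2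
    _ = ∑ j ∈ range jstar, ∑ z ∈ Cell (K - j), X j z := Finset.sum_sigma _ _ _

/-- **THE COUNTING HALF OF NE7b, END TO END AND K-UNIFORM.**  Explicit slots (birth step `j < j⋆ ≤ K`, birth cell
`z ∈ Cell (K − j)`, `#Cell a ≤ V·Λ^a`), explicit records (`records W j K (E j) b`, event universe `E j` on the steps
`(j, K]`, birth kinds `b ∈ B j` with residuals `Σ ρ ≤ ρ̄`), per-step residual entropy `≤ η̄`, and the per-record PRICE
hypothesis `hy` (E2 ∧ R1, NOT proved here) ⇒ the total price of all old slots is at most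
`(ρ̄ e^{−κ₁})·V·(Λσ)^{K − j⋆ + 1}/(1 − Λσ)`, `σ = e^{η̄ − κ₁}`, whenever `Λσ < 1` — the `Σ_i x i ≤ S K` clause of
`T4HistoryPeeling.SlotDom.dom` with EXACTLY the budget of `relWeightBound_of_slotDom_twoRate` (`C := ρ̄ e^{−κ₁}`,
`r := Λσ`).  No uniform window, no event-number floor, no constant depending on `K`. [folklore] -/
theorem oldSlotBudget_le {ε γ : Type*} [DecidableEq ε] (Cell : ℕ → Finset γ) {V Λ : ℝ} (hV : 0 ≤ V) (hΛ : 0 ≤ Λ)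
    (hcell : ∀ a, ((Cell a).card : ℝ) ≤ V * Λ ^ a) (W : ε → ℕ) (step : ε → ℕ) {K : ℕ} (E B : ℕ → Finset ε)
    (hE : ∀ j, ∀ e ∈ E j, step e ∈ Ioc j K) {κ₁ ρbar ηbar : ℝ} (hκ : 0 ≤ κ₁) (ρ : ε → ℝ)
    (hρ : ∀ j, ∀ b ∈ B j, 0 ≤ ρ b) (hρbar : ∀ j, ∑ b ∈ B j, ρ b ≤ ρbar) (η : ε → ℝ)
    (hη : ∀ j, ∀ e ∈ E j, 0 ≤ η e) (hηbar : ∀ j, ∀ t ∈ Ioc j K, ∑ e ∈ E j with step e = t, η e ≤ ηbar)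
    (hr : Λ * Real.exp (ηbar - κ₁) < 1) {jstar : ℕ} (hj : jstar ≤ K) (y : ℕ → γ → ε → Finset ε → ℝ)
    (hy : ∀ j < jstar, ∀ z ∈ Cell (K - j), ∀ b ∈ B j, ∀ Q ∈ records W j K (E j) b,
      y j z b Q ≤ ρ b * Real.exp (-(κ₁ * W b)) * ∏ e ∈ Q, (Real.exp (-(κ₁ * W e)) * η e)) :
    ∑ j ∈ range jstar, ∑ z ∈ Cell (K - j), ∑ b ∈ B j, ∑ Q ∈ records W j K (E j) b, y j z b Q ≤
      ρbar * Real.exp (-κ₁) * V *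
        ((Λ * Real.exp (ηbar - κ₁)) ^ (K - jstar + 1) / (1 - Λ * Real.exp (ηbar - κ₁))) := by
  have hρbar0 : 0 ≤ ρbar := le_trans (Finset.sum_nonneg (hρ 0)) (hρbar 0)
  refine slotBudget_model Cell hV hΛ (mul_nonneg hρbar0 (Real.exp_pos _).le) (Real.exp_pos _).le hr hcell hj
    (fun j z => ∑ b ∈ B j, ∑ Q ∈ records W j K (E j) b, y j z b Q) ?_
  intro j hjlt z hz
  exact slotPrice_le W (le_trans (le_of_lt hjlt) hj) (E j) (B j) step (hE j) hκ ρ (hρ j) (hρbar j) η (hη j)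
    (hηbar j) (y j z) (hy j hjlt z hz)

/-- **PACKAGING INTO THE CONSUMER'S CARRIER `T4HistoryPeeling.SlotDom` WITH THE TWO-RATE BUDGET.**  Per `(K, t)`:
a switch-off structure `Φ` on the run's term family whose bad class is `Bad K t` (R-struct of `T4HistoryPeeling`), a
labelling of its slots by (birth step `< j⋆ K`, birth cell `∈ Cell K (K − birth)`) injective on slots (R4: distinct
pending structures have distinct birth data), per-record prices
`0 ≤ y i b Q ≤ ρ b · e^{−κ₁ W b} ∏_{e∈Q} e^{−κ₁ W e} η e` over the records of the event universe `E K (birth i)` with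
birth kinds `B K (birth i)` (E2 ∧ R1 — the ANALYTIC input, NOT proved here), and the single-slot ratio bound with ratio
`Σ_b Σ_Q y i b Q` (switching slot `i` on in any context costs at most the sum of its record prices) ⇒
`SlotDom l₀ T A Bad S` with EXACTLY the budget `S K = (ρ̄ e^{−κ₁})·V·(Λσ)^{K − j⋆ K + 1}/(1 − Λσ)`, `σ = e^{η̄ − κ₁}`,
consumed by `T4HistoryPeeling.relWeightBound_of_slotDom_twoRate` / `T4MatchingClosure.relWeightBound_of_slotDom_twoRate_log`
(`C := ρ̄ e^{−κ₁}`, `r := Λσ`), for EVERY cutoff `K` with ONE set of constants.  The counting (records, births,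
geometric sums) is discharged by §1–§3; what remains hypothesis is analytic (prices) or interpretive (the dictionary). [folklore] -/
theorem slotDom_of_records {ι γ ε : Type*} [DecidableEq ι] [DecidableEq γ] [DecidableEq ε] {l₀ : ℝ}
    {T : ℕ → Finset ι} {A : ℕ → ℝ → ι → ℝ} {Bad : ℕ → ℝ → Finset ι} (Cell : ℕ → ℕ → Finset γ) {V Λ : ℝ}
    (hV : 0 ≤ V) (hΛ : 0 ≤ Λ) (hcell : ∀ K a, ((Cell K a).card : ℝ) ≤ V * Λ ^ a) (W : ε → ℕ) (step : ε → ℕ)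
    (E B : ℕ → ℕ → Finset ε) (hE : ∀ K j, ∀ e ∈ E K j, step e ∈ Ioc j K) {κ₁ ρbar ηbar : ℝ} (hκ : 0 ≤ κ₁)
    (ρ : ε → ℝ) (hρ : ∀ K j, ∀ b ∈ B K j, 0 ≤ ρ b) (hρbar : ∀ K j, ∑ b ∈ B K j, ρ b ≤ ρbar) (η : ε → ℝ)
    (hη : ∀ K j, ∀ e ∈ E K j, 0 ≤ η e)
    (hηbar : ∀ K j, ∀ t ∈ Ioc j K, ∑ e ∈ E K j with step e = t, η e ≤ ηbar)
    (hr : Λ * Real.exp (ηbar - κ₁) < 1) (jstar : ℕ → ℕ) (hj : ∀ K, jstar K ≤ K)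
    (hdom : ∀ K t, |t| ≤ l₀ → ∃ (n : ℕ) (Φ : SwitchOff (T K) n) (birth : Fin n → ℕ) (cell : Fin n → γ)
        (y : Fin n → ε → Finset ε → ℝ),
      Bad K t = Φ.bad ∧ (∀ i, birth i < jstar K) ∧ (∀ i, cell i ∈ Cell K (K - birth i)) ∧
      Function.Injective (fun i => (⟨birth i, cell i⟩ : Σ _ : ℕ, γ)) ∧
      (∀ i, ∀ b ∈ B K (birth i), ∀ Q ∈ records W (birth i) K (E K (birth i)) b, 0 ≤ y i b Q) ∧
      (∀ i, ∀ b ∈ B K (birth i), ∀ Q ∈ records W (birth i) K (E K (birth i)) b,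
        y i b Q ≤ ρ b * Real.exp (-(κ₁ * W b)) * ∏ e ∈ Q, (Real.exp (-(κ₁ * W e)) * η e)) ∧
      ∀ i : Fin n, ∀ τ'' ∈ T K, Φ.pend i τ'' = false →
        ∑ τ ∈ T K with (Φ.pend i τ = true ∧ Φ.off i τ = τ''), A K t τ ≤
          (∑ b ∈ B K (birth i), ∑ Q ∈ records W (birth i) K (E K (birth i)) b, y i b Q) * A K t τ'') :
    SlotDom l₀ T A Bad fun K => ρbar * Real.exp (-κ₁) * V *
      ((Λ * Real.exp (ηbar - κ₁)) ^ (K - jstar K + 1) / (1 - Λ * Real.exp (ηbar - κ₁))) where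
  dom K t ht := by
    obtain ⟨n, Φ, birth, cell, y, hBad, hold, hmem, hinj, hy0, hy, h1⟩ := hdom K t ht
    refine ⟨n, Φ, fun i => ∑ b ∈ B K (birth i), ∑ Q ∈ records W (birth i) K (E K (birth i)) b, y i b Q,
      fun i => Finset.sum_nonneg fun b hb => Finset.sum_nonneg (hy0 i b hb), ?_, hBad, h1⟩
    have hρbar0 : 0 ≤ ρbar := le_trans (Finset.sum_nonneg (hρ K 0)) (hρbar K 0)
    have hC : 0 ≤ ρbar * Real.exp (-κ₁) := mul_nonneg hρbar0 (Real.exp_pos _).le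
    have hσ : 0 ≤ Real.exp (ηbar - κ₁) := (Real.exp_pos _).le
    calc ∑ i, ∑ b ∈ B K (birth i), ∑ Q ∈ records W (birth i) K (E K (birth i)) b, y i b Q
        ≤ ∑ j ∈ range (jstar K), ∑ _z ∈ Cell K (K - j), ρbar * Real.exp (-κ₁) * Real.exp (ηbar - κ₁) ^ (K - j) :=
          sum_le_of_injOn_slots univ birth cell (Cell K) (fun i _ => hold i) (fun i _ => hmem i) hinj.injOn
            (fun i => ∑ b ∈ B K (birth i), ∑ Q ∈ records W (birth i) K (E K (birth i)) b, y i b Q)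
            (fun j _ => ρbar * Real.exp (-κ₁) * Real.exp (ηbar - κ₁) ^ (K - j))
            (fun i _ => slotPrice_le W (le_trans (le_of_lt (hold i)) (hj K)) (E K (birth i)) (B K (birth i)) step
              (hE K (birth i)) hκ ρ (hρ K (birth i)) (hρbar K (birth i)) η (hη K (birth i)) (hηbar K (birth i))
              (y i) (hy i))
            fun j _ z _ => mul_nonneg hC (pow_nonneg hσ _)
      _ ≤ ρbar * Real.exp (-κ₁) * V *
            ((Λ * Real.exp (ηbar - κ₁)) ^ (K - jstar K + 1) / (1 - Λ * Real.exp (ηbar - κ₁))) :=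
          slotBudget_model (Cell K) hV hΛ hC hσ hr (hcell K) (hj K)
            (fun j _ => ρbar * Real.exp (-κ₁) * Real.exp (ηbar - κ₁) ^ (K - j)) fun j _ z _ => le_rfl

end Budget

/-! ## §4 The rate condition -/

section Rate

/-- **THE RATE CONDITION**: with positional entropy `Λ = L^d` per step of age and survival rate `σ = e^{η̄ − κ₁}`,
`Λσ < 1` as soon as `d·log L + η̄ < κ₁`. [folklore] -/
theorem twoRate_lt_one_of_margin {L : ℕ} (hL : 1 ≤ L) (d : ℕ) {κ₁ ηbar : ℝ}
    (h : (d : ℝ) * Real.log L + ηbar < κ₁) : ((L : ℝ) ^ d) * Real.exp (ηbar - κ₁) < 1 := by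
  have hL0 : (0 : ℝ) < L := by exact_mod_cast hL
  have h1 : ((L : ℝ) ^ d) = Real.exp ((d : ℝ) * Real.log L) := by
    rw [Real.exp_nat_mul, Real.exp_log hL0]
  rw [h1, ← Real.exp_add, Real.exp_lt_one_iff]
  linarith

/-- **LINK TO THE CELL'S `survivalRate` BY NAME** (`d = 4`; rate `κ₁ = p/N` per step from a credit `p` per window `N`,
residual entropy `η̄ = E/N` per step): `L⁴ · e^{E/N − p/N} < 1 ↔ 0 < T4WeightBudget.survivalRate p E N L`
(`T4WeightBudget.exp_entropy_mul_exp_survival_lt_one_iff`). [folklore] -/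
theorem pow_four_mul_exp_lt_one_iff {p E N : ℝ} {L : ℕ} (hL : 1 ≤ L) :
    ((L : ℝ) ^ 4) * Real.exp (E / N - p / N) < 1 ↔ 0 < survivalRate p E N L := by
  have hL0 : (0 : ℝ) < L := by exact_mod_cast hL
  have h1 : ((L : ℝ) ^ 4) = Real.exp (4 * Real.log L) := by
    rw [show (4 : ℝ) * Real.log L = ((4 : ℕ) : ℝ) * Real.log L by norm_num, Real.exp_nat_mul, Real.exp_log hL0]
  have h2 : E / N - p / N = -((p - E) / N) := by ring
  rw [h1, h2]
  exact exp_entropy_mul_exp_survival_lt_one_iff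

end Rate

/-! ## §5 The survival condition against the printed exponent profile: «(1 + o(1))» made exact -/

section Threshold

/-- `1 ≤ R` (as a real number) for a window tied to a coupling by the typed B14 (2.5) `B14.IsRj` with `L ≥ 1`
(`R = L^s`). [folklore] -/
theorem one_le_cast_of_isRj {L r : ℕ} (hL : 1 ≤ L) {g : ℝ} {R : ℕ} (h : B14.IsRj L r g R) : (1 : ℝ) ≤ (R : ℝ) := by
  obtain ⟨s, hR, _, _⟩ := h
  subst hR
  exact_mod_cast one_le_pow₀ (M₀ := ℕ) hL

/-- **THE EVENT CREDIT DOMINATES ITS OWN WINDOW, AT RATE `κ₁` WITH MARGIN `E`, ALONG THE WHOLE RUN** — the per-event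
split consumed by `pairedRecordSum_le`, from the PRINTED exponent profile.  Run `g 0, …, g K` with the tree's typed
B14 (2.7) (`B14.FlowIneq27`, first member) and windows `R s` tied to `g s` by the typed (2.5) (`B14.IsRj`), `r ≤ p₀`,
`1 ≤ log g_s⁻²`; event windows `W s ≤ (1 + F)·R s` (`F ≥ 0`: the printed O(1) slack «n₁ < 10» p. 387 / reset
«K = R_{j+1}» p. 386 — READING (P2)); banked credit `c·p₀(g_s)` per event at scale `s` (READING (P1)/(R1)).  Under the
single closed-form γ-CLAUSE on the infrared coupling, `L(1+β₀)((1+F)κ₁ + E) ≤ c·A₀·(log g_K⁻²)^{p₀−r}`, one has at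
EVERY scale `s ≤ K`: `κ₁·W s + E ≤ c·p0Profile A₀ p₀ (g s)`.  Kernel: `T4ScalePairing.kappa_mul_R_le_p0Profile`
(the ratio credit/window is bounded below by `kappa … (log g_K⁻²)` uniformly in `s` and `K`). [folklore] -/
theorem credit_dominates_window {g : ℕ → ℝ} {R W : ℕ → ℕ} {β' β₀ A₀ c F E κ₁ : ℝ} {L p₀ r K : ℕ}
    (h27 : B14.FlowIneq27 g β' β₀ p₀ K) (hR : ∀ s, s ≤ K → B14.IsRj L r (g s) (R s))
    (hrp : r ≤ p₀) (hL : 1 ≤ L) (hβ : 0 ≤ β₀) (hA : 0 ≤ A₀) (hc : 0 ≤ c) (hE : 0 ≤ E) (hκ : 0 ≤ κ₁)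
    (hx1 : ∀ s, s ≤ K → 1 ≤ Real.log ((g s) ^ 2)⁻¹)
    (hW : ∀ s, s ≤ K → (W s : ℝ) ≤ (1 + F) * R s)
    (hγ : (L : ℝ) * (1 + β₀) * ((1 + F) * κ₁ + E) ≤ c * A₀ * (Real.log ((g K) ^ 2)⁻¹) ^ (p₀ - r)) :
    ∀ s, s ≤ K → κ₁ * W s + E ≤ c * p0Profile A₀ p₀ (g s) := by
  intro s hs
  have hL0 : (0 : ℝ) < L := by exact_mod_cast hL
  have hden : (0 : ℝ) < (L : ℝ) * (1 + β₀) := mul_pos hL0 (by linarith)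
  have hRs : (1 : ℝ) ≤ R s := one_le_cast_of_isRj hL (hR s hs)
  -- the ratio theorem: κ(g_K) · R_s ≤ p₀(g_s)
  have hpair := kappa_mul_R_le_p0Profile h27 hR hrp hL hβ hA hx1 s hs
  -- the γ-clause in ratio form: (1+F)κ₁ + E ≤ c · κ(g_K)
  have hκc : (1 + F) * κ₁ + E ≤ c * kappa A₀ L β₀ p₀ r (Real.log ((g K) ^ 2)⁻¹) := by
    unfold kappa
    rw [mul_div_assoc', le_div_iff₀ hden]
    calc ((1 + F) * κ₁ + E) * ((L : ℝ) * (1 + β₀)) = (L : ℝ) * (1 + β₀) * ((1 + F) * κ₁ + E) := by ring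
      _ ≤ c * A₀ * (Real.log ((g K) ^ 2)⁻¹) ^ (p₀ - r) := hγ
      _ = c * (A₀ * (Real.log ((g K) ^ 2)⁻¹) ^ (p₀ - r)) := by ring
  have hFκ : 0 ≤ (1 + F) * κ₁ + E := by
    have hF1 : 0 ≤ 1 + F := by
      have := hW s hs
      have hW0 : (0 : ℝ) ≤ W s := Nat.cast_nonneg _
      nlinarith
    exact add_nonneg (mul_nonneg hF1 hκ) hE
  calc κ₁ * W s + E ≤ κ₁ * ((1 + F) * R s) + E * R s := by
        have h1 : κ₁ * (W s : ℝ) ≤ κ₁ * ((1 + F) * R s) := mul_le_mul_of_nonneg_left (hW s hs) hκ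
        have h2 : E ≤ E * R s := by nlinarith
        linarith
    _ = ((1 + F) * κ₁ + E) * R s := by ring
    _ ≤ c * kappa A₀ L β₀ p₀ r (Real.log ((g K) ^ 2)⁻¹) * R s :=
        mul_le_mul_of_nonneg_right hκc (by linarith)
    _ = c * (kappa A₀ L β₀ p₀ r (Real.log ((g K) ^ 2)⁻¹) * R s) := by ring
    _ ≤ c * p0Profile A₀ p₀ (g s) := mul_le_mul_of_nonneg_left hpair hc

/-- **THE γ-CLAUSE HOLDS BEYOND AN EXPLICIT THRESHOLD** (the «(1 + o(1))» of the node text, exactly): for `B ≥ 0`,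
`cA > 0`, `n ≥ 1`: `B ≤ cA·x^n` for every `x ≥ max 1 (B/cA)`. [folklore] -/
theorem gammaClause_of_large {B cA : ℝ} {n : ℕ} (hcA : 0 < cA) (hn : 1 ≤ n) {x : ℝ}
    (hx : max 1 (B / cA) ≤ x) : B ≤ cA * x ^ n := by
  have hx1 : 1 ≤ x := le_trans (le_max_left _ _) hx
  have hx2 : B / cA ≤ x := le_trans (le_max_right _ _) hx
  have hxn : x ≤ x ^ n := le_self_pow₀ hx1 (by omega)
  calc B = cA * (B / cA) := by field_simp
    _ ≤ cA * x := mul_le_mul_of_nonneg_left hx2 hcA.le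
    _ ≤ cA * x ^ n := mul_le_mul_of_nonneg_left hxn hcA.le

/-- **EXPLICIT THRESHOLD FOR THE SURVIVAL CONDITION** (the node's side condition «p₀(g)/N > 4 log L·(1 + o(1))», exact
and cutoff-free): if `r < p₀` and `c·A₀ > 0` then with
`x₀ := max 1 (L(1+β₀)((1+F)κ₁ + E)/(c A₀))` the γ-clause of `credit_dominates_window` holds for every infrared value
`log g_K⁻² ≥ x₀` — for ANY target rate `κ₁` (e.g. `κ₁ > d log L + log(1 + η̄)`, §4) and ANY entropy margin `E`. [folklore] -/
theorem gammaClause_of_threshold {β₀ A₀ c F E κ₁ xK : ℝ} {L p₀ r : ℕ} (hrp : r < p₀) (hcA : 0 < c * A₀)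
    (hx : max 1 ((L : ℝ) * (1 + β₀) * ((1 + F) * κ₁ + E) / (c * A₀)) ≤ xK) :
    (L : ℝ) * (1 + β₀) * ((1 + F) * κ₁ + E) ≤ c * A₀ * xK ^ (p₀ - r) :=
  gammaClause_of_large hcA (by omega) hx

/-- Eventual form: `∃ x₀, ∀ x_K ≥ x₀`, the γ-clause. [folklore] -/
theorem exists_threshold {β₀ A₀ c F E κ₁ : ℝ} {L p₀ r : ℕ} (hrp : r < p₀) (hcA : 0 < c * A₀) :
    ∃ x₀ : ℝ, ∀ xK, x₀ ≤ xK → (L : ℝ) * (1 + β₀) * ((1 + F) * κ₁ + E) ≤ c * A₀ * xK ^ (p₀ - r) :=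
  ⟨_, fun _ hx => gammaClause_of_threshold hrp hcA hx⟩

/-- **THE TWO CONDITIONS TOGETHER** (what a consumer of `oldSlotBudget_le` / `slotDom_of_records` needs from print's
exponents): given `d`, `L`, a per-step residual entropy `η̄ ≥ 0` and the rate `κ₁ := d·log L + η̄ + 1`, the run
hypotheses of `credit_dominates_window` and the γ-clause at `κ₁` yield BOTH `Λσ < 1` (`Λ = L^d`, `σ = e^{η̄ − κ₁}`) AND
the per-event split `κ₁ W s + E ≤ c p₀(g_s)` at every scale `s ≤ K` — with constants depending on the infrared value
`log g_K⁻²` only, the same at every cutoff. [folklore] -/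
theorem survival_package {g : ℕ → ℝ} {R W : ℕ → ℕ} {β' β₀ A₀ c F E ηbar : ℝ} {L p₀ r K d : ℕ}
    (h27 : B14.FlowIneq27 g β' β₀ p₀ K) (hR : ∀ s, s ≤ K → B14.IsRj L r (g s) (R s))
    (hrp : r ≤ p₀) (hL : 1 ≤ L) (hβ : 0 ≤ β₀) (hA : 0 ≤ A₀) (hc : 0 ≤ c) (hE : 0 ≤ E) (hη : 0 ≤ ηbar)
    (hx1 : ∀ s, s ≤ K → 1 ≤ Real.log ((g s) ^ 2)⁻¹)
    (hW : ∀ s, s ≤ K → (W s : ℝ) ≤ (1 + F) * R s)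
    (hγ : (L : ℝ) * (1 + β₀) * ((1 + F) * ((d : ℝ) * Real.log L + ηbar + 1) + E) ≤
      c * A₀ * (Real.log ((g K) ^ 2)⁻¹) ^ (p₀ - r)) :
    ((L : ℝ) ^ d) * Real.exp (ηbar - ((d : ℝ) * Real.log L + ηbar + 1)) < 1 ∧
      ∀ s, s ≤ K → ((d : ℝ) * Real.log L + ηbar + 1) * W s + E ≤ c * p0Profile A₀ p₀ (g s) := by
  have hL1 : (1 : ℝ) ≤ L := by exact_mod_cast hL
  have hκ : 0 ≤ (d : ℝ) * Real.log L + ηbar + 1 := by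
    have h1 : 0 ≤ Real.log (L : ℝ) := Real.log_nonneg hL1
    positivity
  exact ⟨twoRate_lt_one_of_margin hL d (by linarith),
    credit_dominates_window h27 hR hrp hL hβ hA hc hE hκ hx1 hW hγ⟩

end Threshold

/-! ## §6 Numerical instance at the cell's SMALLNESS.md §4.3 witnesses -/

section Numbers

/-- `4·log 13 + 1 < 50` (only input: `x + 1 < e^x`). [folklore] -/
theorem rate_margin_13 : (4 : ℝ) * Real.log 13 + 1 < 50 := by
  have h1 : Real.log 13 < 12 := by
    rw [Real.log_lt_iff_lt_exp (by norm_num)]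
    have := Real.add_one_lt_exp (show (12 : ℝ) ≠ 0 by norm_num)
    linarith
  linarith

/-- The RATE CONDITION at `d = 4`, `L = 13`, per-step residual entropy `η̄ = 1`, `κ₁ = 50`: `13⁴ · e^{1 − 50} < 1`.
[folklore] -/
theorem rate_condition_13 : ((13 : ℕ) : ℝ) ^ 4 * Real.exp ((1 : ℝ) - 50) < 1 :=
  twoRate_lt_one_of_margin (L := 13) (by norm_num) 4 (by
    have := rate_margin_13; push_cast; linarith)

/-- The γ-CLAUSE at the SMALLNESS.md §4.3/§4.4 witnesses `L = 13`, `β₀ = 1/7`, `p₀ = 23`, `r₀ = 2`, `F = 10`,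
`c = (2(1+β₀))⁻¹ = 7/16`, `A₀ = 1`, `κ₁ = 50`, entropy margin `E = 10^40`, infrared value `log g_K⁻² = 254`:
`13·(8/7)·(11·50 + 10^40) ≤ (7/16)·254^21` (left side ≈ 1.5·10^41, right side ≈ 1.4·10^50).  [v1.1, DOCFIX G-t4r2-1]
The remaining §4.3 witness `p₁ = 21` (print's proviso «2p₁ − (d+5)r₀ > p₀» p. 383 for the renewal credit, and
`p₁ < p₀`: window `21 ≤ p₁ < 23`) does not enter this inequality; it is checked in §10 `exponent_constraints_23`.
This section verifies ONLY the γ-clause / rate arithmetic, no analytic input. [folklore] -/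
theorem gamma_clause_13 :
    (13 : ℝ) * (1 + 1 / 7) * ((1 + 10) * 50 + 10 ^ 40) ≤ 7 / 16 * 1 * (254 : ℝ) ^ (23 - 2) := by
  norm_num

end Numbers

/-! ## §7 The uniform-window special case: the counting hypotheses of the kernel's existing route -/

section Uniform

/-- Gap-vector records with `m` events, gaps in `[1, N]`, of a structure born at `j` and pending at `K` under a UNIFORM
window `N`: the last event is within `N` steps of `K + 1`. [folklore] -/
def gapRecordsPending (N j K m : ℕ) : Finset (Fin m → ℕ) :=
  (Fintype.piFinset fun _ : Fin m => Icc 1 N).filter fun gv => j + ∑ i, gv i ≤ K ∧ K < j + ∑ i, gv i + N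

/-- `recordSum_le`'s `hcount` in the uniform-window model: at most `N^m` pending records with `m` events
(`T4JointInsertionProfile.card_gapRecords`). [folklore] -/
theorem card_gapRecordsPending_le (N j K m : ℕ) : (gapRecordsPending N j K m).card ≤ N ^ m := by
  calc (gapRecordsPending N j K m).card ≤ (Fintype.piFinset fun _ : Fin m => Icc 1 N).card :=
        Finset.card_filter_le _ _
    _ = N ^ m := by rw [Fintype.card_piFinset_const, Nat.card_Icc, Nat.add_sub_cancel]

/-- `recordSum_le`'s `hm` / `pow_eventCount_le_twoRate`'s `hwin` in the uniform-window model: a pending record with `m`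
events satisfies `K + 1 − j ≤ N·(m + 1)`. [folklore] -/
theorem window_of_gapRecordPending {N j K m : ℕ} {gv : Fin m → ℕ} (h : gv ∈ gapRecordsPending N j K m) :
    K + 1 - j ≤ N * (m + 1) := by
  obtain ⟨hgv, _, h2⟩ := Finset.mem_filter.1 h
  have hle : ∑ i, gv i ≤ ∑ _i : Fin m, N :=
    Finset.sum_le_sum fun i _ => (Finset.mem_Icc.1 (Fintype.mem_piFinset.1 hgv i)).2
  rw [Finset.sum_const, Finset.card_univ, Fintype.card_fin, smul_eq_mul] at hle
  have : K + 1 - j ≤ ∑ i, gv i + N := by omega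
  calc K + 1 - j ≤ ∑ i, gv i + N := this
    _ ≤ m * N + N := by omega
    _ = N * (m + 1) := by ring

end Uniform

/-! ## §8 Sanity -/

/-- One event (step 2, kind 0) of a structure born at step 0 (birth event `(0, 0)`), pending at step 3, all windows 2:
admissible (`[0,3] ⊆ [0,2) ∪ [2,4)`), hence the span condition `4 ≤ 2 + 2`. -/
example : Admissible (fun _ => 2) 0 3 (0, 0) {(2, 0)} := by decide

example : SpanLE (fun _ : ℕ × ℕ => 2) 0 3 (0, 0) {(2, 0)} := by decide

/-- … without the event neither holds (step 2 uncovered; `4 ≰ 2`). -/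
example : ¬ Admissible (fun _ => 2) 0 3 (0, 0) ∅ := by decide

example : ¬ SpanLE (fun _ : ℕ × ℕ => 2) 0 3 (0, 0) ∅ := by decide

/-- A DEFERRED window (merger reading): birth `(0,0)` with window 3, a merger event at step 1 whose fresh window of
length 2 is placed at the old horizon 3: `[0,3) ∪ [3,5) ⊇ [0,4]`, so the record `{(1,0)}` of a structure pending at
step 4 satisfies the span condition `5 ≤ 3 + 2` although immediate placement `[1,3)` would not cover. -/
example : Covers (fun e : ℕ × ℕ => if e.1 = 0 then 3 else 2) 0 4 (0, 0) {(1, 0)}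
    (fun e => if e.1 = 0 then 0 else 3) := by decide

example : SpanLE (fun e : ℕ × ℕ => if e.1 = 0 then 3 else 2) 0 4 (0, 0) {(1, 0)} := by decide

example : ¬ Admissible (fun e : ℕ × ℕ => if e.1 = 0 then 3 else 2) 0 4 (0, 0) {(1, 0)} := by decide

/-- The record space is finite and explicit: with event universe `{(1,0),(2,0),(3,0)}`, windows 2, birth `(0,0)`, a
structure pending at step 3 has exactly the records containing an event covering the span deficit:
`#records = #{Q ⊆ E : 4 ≤ 2 + 2·#Q} = 7` (all non-empty subsets). -/
example : (records (fun _ : ℕ × ℕ => 2) 0 3 {(1, 0), (2, 0), (3, 0)} (0, 0)).card = 7 := by decide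

/-- Positions of the scale-`j` lattice in a torus of `2^4` unit blocks at age `3`, `L = 13`: `2^4 · (13^4)^3`. -/
example : Fintype.card (Fin 4 → Fin (2 * 13 ^ 3)) = 2 ^ 4 * (13 ^ 4) ^ 3 := card_torusCells 4 2 13 3

/-! ## §9 The printed R-polynomial control cost: «for p₀ large and γ small enough» made exact (v1.1) -/

section PolyCost

/-- **(2.5) IS STABLE UNDER POWERS.**  If `R` is the (2.5)-window of `g` for `(L, r)` (`B14.IsRj L r g R`: `R = L^s` with
`s` least such that `(log g⁻²)^r ≤ L^s`) and `0 ≤ log g⁻²`, then `R^q` is the (2.5)-window of `g` for `(L^q, r·q)`, for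
every `q : ℕ` (same exponent `s`; minimality transfers through `t ↦ t^q`).  This lets the RATIO THEOREM
`T4ScalePairing.kappa_mul_R_le_p0Profile` price any POWER of the window against the profile. [folklore] -/
theorem isRj_pow {L r : ℕ} {g : ℝ} {R : ℕ} (h : B14.IsRj L r g R) (hx : 0 ≤ Real.log (g ^ 2)⁻¹) (q : ℕ) :
    B14.IsRj (L ^ q) (r * q) g (R ^ q) := by
  obtain ⟨s, hR, hle, hmin⟩ := h
  rcases Nat.eq_zero_or_pos q with hq | hq
  · subst hq
    refine ⟨0, by simp, by simp, fun s' _ => Nat.zero_le _⟩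
  · refine ⟨s, ?_, ?_, ?_⟩
    · rw [hR, ← pow_mul, ← pow_mul, Nat.mul_comm]
    · rw [pow_mul]
      push_cast
      exact pow_le_pow_left₀ (pow_nonneg hx r) hle q
    · intro s' hs'
      apply hmin s'
      rw [pow_mul] at hs'
      have e : (((L ^ q) ^ s' : ℕ) : ℝ) = (((L ^ s' : ℕ) : ℝ)) ^ q := by
        push_cast; rw [← pow_mul, ← pow_mul, Nat.mul_comm]
      rw [e] at hs'
      exact (pow_le_pow_iff_left₀ (pow_nonneg hx r) (by positivity) hq.ne').mp hs'

/-- **THE EVENT CREDIT DOMINATES ITS WINDOW AND AN R-POLYNOMIAL CONTROL COST, ALONG THE WHOLE RUN** (v1.1; the per-event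
split of §2 with the PRINTED SHAPE of the control cost).  Print's per-event costs are polynomial in the window: the reset
«κ_{j+1}(Z) = p₀(g_j) − O(1)M^dR^{d+1}_{j+1}d′_{j+1}(Z)» (p. 386), the merger bookkeeping «+ O(1)3(100M)^dR_{j+1}^{d+2}»
((1.88) p. 387) and the K-step cost of (1.80) p. 384 «Σ_{n=j+1}^{j+K}O(1)M^dR_n^{d+1}d′_n(S^{n−j}(Z))» with the
small-domain size bound «d′_n(S^{n−j}(Z)) ≤ (64)^d if it is equal to 0» (p. 384, the linear size of `Z^{(n−j)}` being 0;
a renewed component is such a small domain: «contained in a cube of the size 100MR_{j+1}, hence K = R_{j+1} for Z»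
p. 386) — all ABSORBED in print by «for p₀ large and γ small enough» (p. 387).  [v1.3 DOCFIX D1: adapted text formerly
inside guillemets replaced by the verbatim displays; no statement changed.]
This theorem is that absorption, exactly and K-uniformly: with the run hypotheses of `credit_dominates_window`
(typed B14 (2.7) `B14.FlowIneq27`, typed (2.5) `B14.IsRj`, `1 ≤ log g_s⁻²`, event windows `W s ≤ (1+F)·R s`), a cost
margin `E₀ + E₁·(R s)^q` at an event of scale `s`, the EXPONENT CONDITIONS `r ≤ p₀` and `r·q ≤ p₀` («p₀ large»: the
cell's SMALLNESS.md (X7) `p₀ > (d+2)r₀` at `q = d+2`, rows S-B16.10/S-B16.11) and TWO closed-form γ-CLAUSES on the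
infrared coupling `g_K` alone («γ small»), one has at EVERY scale `s ≤ K`:
`κ₁·W s + E₀ + E₁·(R s)^q ≤ (c₁ + c₂)·p₀(g_s)`.  Kernel: v1's `credit_dominates_window` (clause 1) and the ratio
theorem applied to `(L^q, r·q, (R s)^q)` via `isRj_pow` (clause 2).  The printed O(1)·M^d constants stay symbolic in
`E₀`, `E₁` (print fixes neither O(1) nor M); the identification with print's costs is READING (ID), as in v1. [folklore] -/
theorem credit_dominates_window_poly {g : ℕ → ℝ} {R W : ℕ → ℕ} {β' β₀ A₀ c₁ c₂ F E₀ E₁ κ₁ : ℝ} {L p₀ r q K : ℕ}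
    (h27 : B14.FlowIneq27 g β' β₀ p₀ K) (hR : ∀ s, s ≤ K → B14.IsRj L r (g s) (R s))
    (hrp : r ≤ p₀) (hrq : r * q ≤ p₀) (hL : 1 ≤ L) (hβ : 0 ≤ β₀) (hA : 0 ≤ A₀) (hc₁ : 0 ≤ c₁) (hc₂ : 0 ≤ c₂)
    (hE₀ : 0 ≤ E₀) (hκ : 0 ≤ κ₁)
    (hx1 : ∀ s, s ≤ K → 1 ≤ Real.log ((g s) ^ 2)⁻¹)
    (hW : ∀ s, s ≤ K → (W s : ℝ) ≤ (1 + F) * R s)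
    (hγ₁ : (L : ℝ) * (1 + β₀) * ((1 + F) * κ₁ + E₀) ≤ c₁ * A₀ * (Real.log ((g K) ^ 2)⁻¹) ^ (p₀ - r))
    (hγ₂ : (L : ℝ) ^ q * (1 + β₀) * E₁ ≤ c₂ * A₀ * (Real.log ((g K) ^ 2)⁻¹) ^ (p₀ - r * q)) :
    ∀ s, s ≤ K → κ₁ * W s + E₀ + E₁ * (R s : ℝ) ^ q ≤ (c₁ + c₂) * p0Profile A₀ p₀ (g s) := by
  intro s hs
  -- clause 1 (v1): κ₁ W s + E₀ ≤ c₁ p₀(g_s)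
  have h1 : κ₁ * W s + E₀ ≤ c₁ * p0Profile A₀ p₀ (g s) :=
    credit_dominates_window h27 hR hrp hL hβ hA hc₁ hE₀ hκ hx1 hW hγ₁ s hs
  -- clause 2: the ratio theorem for the powered windows (L^q, r q, R^q)
  have hRq : ∀ s, s ≤ K → B14.IsRj (L ^ q) (r * q) (g s) ((fun t => R t ^ q) s) :=
    fun t ht => isRj_pow (hR t ht) (by linarith [hx1 t ht]) q
  have hLq : 1 ≤ L ^ q := Nat.one_le_pow q L hL
  have hpair := kappa_mul_R_le_p0Profile (A₀ := A₀) h27 hRq hrq hLq hβ hA hx1 s hs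
  have hcast : (((fun t => R t ^ q) s : ℕ) : ℝ) = (R s : ℝ) ^ q := by push_cast; rfl
  rw [hcast] at hpair
  -- the second γ-clause in ratio form: E₁ ≤ c₂ κ_q(g_K)
  have hL0 : (0 : ℝ) < L := by exact_mod_cast hL
  have hden : (0 : ℝ) < ((L ^ q : ℕ) : ℝ) * (1 + β₀) := by
    have : (0 : ℝ) < ((L ^ q : ℕ) : ℝ) := by exact_mod_cast Nat.pos_of_ne_zero (by positivity)
    exact mul_pos this (by linarith)
  have hκc : E₁ ≤ c₂ * kappa A₀ (L ^ q) β₀ p₀ (r * q) (Real.log ((g K) ^ 2)⁻¹) := by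
    unfold kappa
    rw [mul_div_assoc', le_div_iff₀ hden]
    calc E₁ * (((L ^ q : ℕ) : ℝ) * (1 + β₀)) = (L : ℝ) ^ q * (1 + β₀) * E₁ := by push_cast; ring
      _ ≤ c₂ * A₀ * (Real.log ((g K) ^ 2)⁻¹) ^ (p₀ - r * q) := hγ₂
      _ = c₂ * (A₀ * (Real.log ((g K) ^ 2)⁻¹) ^ (p₀ - r * q)) := by ring
  have hRq0 : (0 : ℝ) ≤ (R s : ℝ) ^ q := by positivity
  have h2 : E₁ * (R s : ℝ) ^ q ≤ c₂ * p0Profile A₀ p₀ (g s) :=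
    calc E₁ * (R s : ℝ) ^ q ≤ c₂ * kappa A₀ (L ^ q) β₀ p₀ (r * q) (Real.log ((g K) ^ 2)⁻¹) * (R s : ℝ) ^ q :=
          mul_le_mul_of_nonneg_right hκc hRq0
      _ = c₂ * (kappa A₀ (L ^ q) β₀ p₀ (r * q) (Real.log ((g K) ^ 2)⁻¹) * (R s : ℝ) ^ q) := by ring
      _ ≤ c₂ * p0Profile A₀ p₀ (g s) := mul_le_mul_of_nonneg_left hpair hc₂
  calc κ₁ * W s + E₀ + E₁ * (R s : ℝ) ^ q ≤ c₁ * p0Profile A₀ p₀ (g s) + c₂ * p0Profile A₀ p₀ (g s) :=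
        add_le_add h1 h2
    _ = (c₁ + c₂) * p0Profile A₀ p₀ (g s) := by ring

/-- **THE SECOND γ-CLAUSE BEYOND AN EXPLICIT THRESHOLD** («γ small enough» of (1.88), exact): if `r·q < p₀` and
`c₂·A₀ > 0` then `L^q(1+β₀)E₁ ≤ c₂·A₀·x_K^{p₀ − r·q}` for every `x_K ≥ max 1 (L^q(1+β₀)E₁/(c₂A₀))`. [folklore] -/
theorem gammaClausePoly_of_threshold {β₀ A₀ c₂ E₁ xK : ℝ} {L p₀ r q : ℕ} (hrq : r * q < p₀) (hcA : 0 < c₂ * A₀)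
    (hx : max 1 ((L : ℝ) ^ q * (1 + β₀) * E₁ / (c₂ * A₀)) ≤ xK) :
    (L : ℝ) ^ q * (1 + β₀) * E₁ ≤ c₂ * A₀ * xK ^ (p₀ - r * q) :=
  gammaClause_of_large hcA (by omega) hx

/-- **ONE INFRARED THRESHOLD FOR BOTH γ-CLAUSES** (the «(1 + o(1))» of the node text with the printed polynomial
control cost): for `r·q < p₀`, `r < p₀`, `c₁A₀ > 0`, `c₂A₀ > 0` there is `x₀` such that both γ-clauses of
`credit_dominates_window_poly` hold for every infrared value `log g_K⁻² ≥ x₀` — cutoff-free, for ANY `κ₁, E₀, E₁, F`.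
[folklore] -/
theorem exists_threshold_poly {β₀ A₀ c₁ c₂ F E₀ E₁ κ₁ : ℝ} {L p₀ r q : ℕ} (hrp : r < p₀) (hrq : r * q < p₀)
    (hc₁ : 0 < c₁ * A₀) (hc₂ : 0 < c₂ * A₀) :
    ∃ x₀ : ℝ, ∀ xK, x₀ ≤ xK →
      (L : ℝ) * (1 + β₀) * ((1 + F) * κ₁ + E₀) ≤ c₁ * A₀ * xK ^ (p₀ - r) ∧
      (L : ℝ) ^ q * (1 + β₀) * E₁ ≤ c₂ * A₀ * xK ^ (p₀ - r * q) := by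
  refine ⟨max (max 1 ((L : ℝ) * (1 + β₀) * ((1 + F) * κ₁ + E₀) / (c₁ * A₀)))
      (max 1 ((L : ℝ) ^ q * (1 + β₀) * E₁ / (c₂ * A₀))), fun xK hx => ⟨?_, ?_⟩⟩
  · exact gammaClause_of_threshold hrp hc₁ (le_trans (le_max_left _ _) hx)
  · exact gammaClausePoly_of_threshold hrq hc₂ (le_trans (le_max_right _ _) hx)

/-- **THE TWO CONDITIONS TOGETHER, WITH THE PRINTED CONTROL COST** (v1.1 form of `survival_package`): given `d`, `L`,
a per-step residual entropy `η̄ ≥ 0` and the rate `κ₁ := d·log L + η̄ + 1`, the run hypotheses and the two γ-clauses at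
`κ₁` yield BOTH `Λσ < 1` (`Λ = L^d`, `σ = e^{η̄ − κ₁}`) AND the per-event split
`κ₁ W s + E₀ + E₁ (R s)^q ≤ (c₁ + c₂) p₀(g_s)` at every scale `s ≤ K` — constants depending on the infrared value
`log g_K⁻²` only, the same at every cutoff; `q = d + 2` is print's exponent ((1.88)), and `r·q ≤ p₀` is then exactly
the cell's SMALLNESS.md (X7). [folklore] -/
theorem survival_package_poly {g : ℕ → ℝ} {R W : ℕ → ℕ} {β' β₀ A₀ c₁ c₂ F E₀ E₁ ηbar : ℝ} {L p₀ r q K d : ℕ}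
    (h27 : B14.FlowIneq27 g β' β₀ p₀ K) (hR : ∀ s, s ≤ K → B14.IsRj L r (g s) (R s))
    (hrp : r ≤ p₀) (hrq : r * q ≤ p₀) (hL : 1 ≤ L) (hβ : 0 ≤ β₀) (hA : 0 ≤ A₀) (hc₁ : 0 ≤ c₁) (hc₂ : 0 ≤ c₂)
    (hE₀ : 0 ≤ E₀) (hη : 0 ≤ ηbar)
    (hx1 : ∀ s, s ≤ K → 1 ≤ Real.log ((g s) ^ 2)⁻¹)
    (hW : ∀ s, s ≤ K → (W s : ℝ) ≤ (1 + F) * R s)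
    (hγ₁ : (L : ℝ) * (1 + β₀) * ((1 + F) * ((d : ℝ) * Real.log L + ηbar + 1) + E₀) ≤
      c₁ * A₀ * (Real.log ((g K) ^ 2)⁻¹) ^ (p₀ - r))
    (hγ₂ : (L : ℝ) ^ q * (1 + β₀) * E₁ ≤ c₂ * A₀ * (Real.log ((g K) ^ 2)⁻¹) ^ (p₀ - r * q)) :
    ((L : ℝ) ^ d) * Real.exp (ηbar - ((d : ℝ) * Real.log L + ηbar + 1)) < 1 ∧
      ∀ s, s ≤ K → ((d : ℝ) * Real.log L + ηbar + 1) * W s + E₀ + E₁ * (R s : ℝ) ^ q ≤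
        (c₁ + c₂) * p0Profile A₀ p₀ (g s) := by
  have hL1 : (1 : ℝ) ≤ L := by exact_mod_cast hL
  have hκ : 0 ≤ (d : ℝ) * Real.log L + ηbar + 1 := by
    have h1 : 0 ≤ Real.log (L : ℝ) := Real.log_nonneg hL1
    positivity
  exact ⟨twoRate_lt_one_of_margin hL d (by linarith),
    credit_dominates_window_poly h27 hR hrp hrq hL hβ hA hc₁ hc₂ hE₀ hκ hx1 hW hγ₁ hγ₂⟩

/-- **THE K-STEP COST OF (1.80) HAS THE POLYNOMIAL SHAPE** (v1.1).  Print's inductive statement (1.80) p. 384 charges a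
window of `K` steps opened at step `s` with the sum of (1.80) — `Σ_{n=s+1}^{s+K} O(1)M^dR_n^{d+1}d′_n(S^{n−s}(Z))` in the
notation of p. 384 with `j ↦ s` (adapted, not a quotation), `d′_n(S^{n−s}(Z)) ≤ (64)^d` for a small domain (p. 384; a
renewed component p. 386) — a SUM OVER THE WINDOW'S STEPS of terms evaluated at the LATER scales `n`.  With the typed B14
(2.9), first member (`B14FlowStep.FlowIneq29`: `R_n ≤ L·R_m` for `m < n ≤ K`), a per-step cost `E₂·(R n)^{q'}` summed
over the steps `n ∈ (s, s + W s]` of the run (`n ≤ K`: steps beyond the cutoff are not performed) is at most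
`(1+F)·L^{q'}·E₂·(R s)^{q'+1}` when `W s ≤ (1+F)·R s` — i.e. the `E₁·(R s)^q` of `credit_dominates_window_poly` with
`q = q' + 1` (`= d + 2` for `q' = d + 1`, print's (1.88)) and `E₁ = (1+F)L^{q'}E₂`. [folklore] -/
theorem windowCost_le {R W : ℕ → ℕ} {g : ℕ → ℝ} {β' β₀ F E₂ : ℝ} {L K q' s : ℕ}
    (h29 : B14FlowStep.FlowIneq29 R g L β' β₀ K) (hE₂ : 0 ≤ E₂)
    (hW : (W s : ℝ) ≤ (1 + F) * R s) :
    ∑ n ∈ (Finset.Ioc s (s + W s)).filter (· ≤ K), E₂ * (R n : ℝ) ^ q' ≤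
      (1 + F) * (L : ℝ) ^ q' * E₂ * (R s : ℝ) ^ (q' + 1) := by
  have hterm : ∀ n ∈ (Finset.Ioc s (s + W s)).filter (· ≤ K),
      E₂ * (R n : ℝ) ^ q' ≤ E₂ * ((L : ℝ) * R s) ^ q' := by
    intro n hn
    rw [Finset.mem_filter, Finset.mem_Ioc] at hn
    obtain ⟨⟨hsn, _⟩, hnK⟩ := hn
    have h := (h29 s n hsn hnK).1
    exact mul_le_mul_of_nonneg_left (pow_le_pow_left₀ (Nat.cast_nonneg _) h _) hE₂
  have hcard : ((((Finset.Ioc s (s + W s)).filter (· ≤ K)).card : ℕ) : ℝ) ≤ W s := by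
    have h1 := Finset.card_filter_le (Finset.Ioc s (s + W s)) (fun n => n ≤ K)
    have h2 : (Finset.Ioc s (s + W s)).card = W s := by
      rw [Nat.card_Ioc, Nat.add_sub_cancel_left]
    rw [h2] at h1
    exact_mod_cast h1
  calc ∑ n ∈ (Finset.Ioc s (s + W s)).filter (· ≤ K), E₂ * (R n : ℝ) ^ q'
      ≤ ∑ n ∈ (Finset.Ioc s (s + W s)).filter (· ≤ K), E₂ * ((L : ℝ) * R s) ^ q' := Finset.sum_le_sum hterm
    _ = ((((Finset.Ioc s (s + W s)).filter (· ≤ K)).card : ℕ) : ℝ) * (E₂ * ((L : ℝ) * R s) ^ q') := by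
        rw [Finset.sum_const, nsmul_eq_mul]
    _ ≤ (W s : ℝ) * (E₂ * ((L : ℝ) * R s) ^ q') := mul_le_mul_of_nonneg_right hcard (by positivity)
    _ ≤ (1 + F) * R s * (E₂ * ((L : ℝ) * R s) ^ q') := mul_le_mul_of_nonneg_right hW (by positivity)
    _ = (1 + F) * (L : ℝ) ^ q' * E₂ * (R s : ℝ) ^ (q' + 1) := by ring

/-- `Σ_{n ∈ (s, s+W]} (1/2)^{n−s} = 1 − (1/2)^W` (the geometric factor «2^{−(n−j)}» of (1.81) p. 385 summed over a
window). [folklore] -/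
theorem sum_half_pow_Ioc (s W : ℕ) :
    ∑ n ∈ Finset.Ioc s (s + W), (1 / 2 : ℝ) ^ (n - s) = 1 - (1 / 2 : ℝ) ^ W := by
  induction W with
  | zero => simp
  | succ W ih =>
    rw [← add_assoc, Finset.sum_Ioc_succ_top (by omega), ih,
      show s + W + 1 - s = W + 1 by omega, pow_succ]
    ring

/-- **THE DECAYING (SIZE-CARRYING) PART OF THE K-STEP COST** — the FIRST sum of (1.81) p. 385, exactly: print bounds
«Σ_{n=j+1}^{n₀} O(1)M^dR_n^{d+1}3(126)^d2^{−(n−j)}d′_j(Z)» by «O(1)3(126)^dM^dL^{d+1}R_j^{d+1}d′_j(Z)» (R_n ≤ L R_j by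
(2.9), Σ 2^{−(n−j)} ≤ 1; print states the decay «for n − j > 1» only (p. 385 l.1) — weighting also the first step
`n − s = 1` by `(1/2)^{n−s}` costs at most a factor `2`, absorbed in the symbolic `E₃` [v1.3 DOCFIX D2]).  Typed: a
per-step cost `E₃·(R n)^{q'}·(1/2)^{n−s}` summed over the performed steps of a
window opened at `s` is at most `E₃·L^{q'}·(R s)^{q'}` — NO extra power of `R s` (the size factor `d′_j(Z)` sits in
`E₃` and is paid in print by the p₀²-type BIRTH factor of (1.79)/(1.82), i.e. by the birth residual `ρ` of §2 — READING
(ID)). [folklore] -/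
theorem windowCostDecay_le {R W : ℕ → ℕ} {g : ℕ → ℝ} {β' β₀ E₃ : ℝ} {L K q' s : ℕ}
    (h29 : B14FlowStep.FlowIneq29 R g L β' β₀ K) (hE₃ : 0 ≤ E₃) :
    ∑ n ∈ (Finset.Ioc s (s + W s)).filter (· ≤ K), E₃ * (R n : ℝ) ^ q' * (1 / 2 : ℝ) ^ (n - s) ≤
      E₃ * (L : ℝ) ^ q' * (R s : ℝ) ^ q' := by
  have hterm : ∀ n ∈ (Finset.Ioc s (s + W s)).filter (· ≤ K),
      E₃ * (R n : ℝ) ^ q' * (1 / 2 : ℝ) ^ (n - s) ≤ E₃ * ((L : ℝ) * R s) ^ q' * (1 / 2 : ℝ) ^ (n - s) := by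
    intro n hn
    rw [Finset.mem_filter, Finset.mem_Ioc] at hn
    obtain ⟨⟨hsn, _⟩, hnK⟩ := hn
    have h := (h29 s n hsn hnK).1
    apply mul_le_mul_of_nonneg_right _ (by positivity)
    exact mul_le_mul_of_nonneg_left (pow_le_pow_left₀ (Nat.cast_nonneg _) h _) hE₃
  have hgeom : ∑ n ∈ (Finset.Ioc s (s + W s)).filter (· ≤ K), (1 / 2 : ℝ) ^ (n - s) ≤ 1 := by
    calc ∑ n ∈ (Finset.Ioc s (s + W s)).filter (· ≤ K), (1 / 2 : ℝ) ^ (n - s)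
        ≤ ∑ n ∈ Finset.Ioc s (s + W s), (1 / 2 : ℝ) ^ (n - s) :=
          Finset.sum_le_sum_of_subset_of_nonneg (Finset.filter_subset _ _) (fun _ _ _ => by positivity)
      _ = 1 - (1 / 2 : ℝ) ^ (W s) := sum_half_pow_Ioc s (W s)
      _ ≤ 1 := by
          have : (0 : ℝ) ≤ (1 / 2 : ℝ) ^ (W s) := by positivity
          linarith
  have h0 : 0 ≤ E₃ * ((L : ℝ) * R s) ^ q' := by positivity
  calc ∑ n ∈ (Finset.Ioc s (s + W s)).filter (· ≤ K), E₃ * (R n : ℝ) ^ q' * (1 / 2 : ℝ) ^ (n - s)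
      ≤ ∑ n ∈ (Finset.Ioc s (s + W s)).filter (· ≤ K), E₃ * ((L : ℝ) * R s) ^ q' * (1 / 2 : ℝ) ^ (n - s) :=
        Finset.sum_le_sum hterm
    _ = E₃ * ((L : ℝ) * R s) ^ q' * ∑ n ∈ (Finset.Ioc s (s + W s)).filter (· ≤ K), (1 / 2 : ℝ) ^ (n - s) := by
        rw [Finset.mul_sum]
    _ ≤ E₃ * ((L : ℝ) * R s) ^ q' * 1 := mul_le_mul_of_nonneg_left hgeom h0
    _ = E₃ * (L : ℝ) ^ q' * (R s : ℝ) ^ q' := by ring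

/-- **THE EVENT CREDIT DOMINATES ITS WINDOW, A CONSTANT MARGIN AND THE SUMMED PER-STEP COST OF ITS WINDOW** — the
form in which print's (1.80) p. 384 states the K-step control, made exact and K-uniform: `windowCost_le` feeds
`credit_dominates_window_poly` with `q = q' + 1`, `E₁ = (1+F)L^{q'}E₂`.  Hypotheses: typed (2.7), typed (2.9) first
member, typed (2.5), `r ≤ p₀`, `r(q'+1) ≤ p₀` ((X7) at `q' = d + 1`), the window slack `F`, and the two γ-clauses on
`log g_K⁻²`. [folklore] -/
theorem credit_dominates_windowSum {g : ℕ → ℝ} {R W : ℕ → ℕ} {β' β₀ A₀ c₁ c₂ F E₀ E₂ κ₁ : ℝ} {L p₀ r q' K : ℕ}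
    (h27 : B14.FlowIneq27 g β' β₀ p₀ K) (h29 : B14FlowStep.FlowIneq29 R g L β' β₀ K)
    (hR : ∀ s, s ≤ K → B14.IsRj L r (g s) (R s))
    (hrp : r ≤ p₀) (hrq : r * (q' + 1) ≤ p₀) (hL : 1 ≤ L) (hβ : 0 ≤ β₀) (hA : 0 ≤ A₀) (hc₁ : 0 ≤ c₁)
    (hc₂ : 0 ≤ c₂) (hE₀ : 0 ≤ E₀) (hE₂ : 0 ≤ E₂) (hκ : 0 ≤ κ₁)
    (hx1 : ∀ s, s ≤ K → 1 ≤ Real.log ((g s) ^ 2)⁻¹)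
    (hW : ∀ s, s ≤ K → (W s : ℝ) ≤ (1 + F) * R s)
    (hγ₁ : (L : ℝ) * (1 + β₀) * ((1 + F) * κ₁ + E₀) ≤ c₁ * A₀ * (Real.log ((g K) ^ 2)⁻¹) ^ (p₀ - r))
    (hγ₂ : (L : ℝ) ^ (q' + 1) * (1 + β₀) * ((1 + F) * (L : ℝ) ^ q' * E₂) ≤
      c₂ * A₀ * (Real.log ((g K) ^ 2)⁻¹) ^ (p₀ - r * (q' + 1))) :
    ∀ s, s ≤ K → κ₁ * W s + E₀ + ∑ n ∈ (Finset.Ioc s (s + W s)).filter (· ≤ K), E₂ * (R n : ℝ) ^ q' ≤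
      (c₁ + c₂) * p0Profile A₀ p₀ (g s) := by
  intro s hs
  have h1 := windowCost_le (q' := q') h29 hE₂ (hW s hs)
  have h2 := credit_dominates_window_poly h27 hR hrp hrq hL hβ hA hc₁ hc₂ hE₀ hκ hx1 hW hγ₁ hγ₂ s hs
  linarith

end PolyCost

/-! ## §10 Numerical instance of §9 at the cell's SMALLNESS.md §4.3 witnesses (v1.1) -/

section NumbersPoly

/-- The printed EXPONENT CONSTRAINTS at the SMALLNESS.md §4.3 witnesses `d = 4`, `r₀ = 2`, `p₀ = 23`, `p₁ = 21`:
(X6) «2p₁ − (d+5)r₀ > p₀» (p. 383; the proviso under which the renewal credit `exp(−p₀(g_j))` is printed):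
`2·21 − 9·2 = 24 > 23`; `p₁ < p₀`: `21 < 23`; (X7) «p₀ large» at print's control-cost exponent `q = d + 2 = 6`
((1.88)): `r₀·q = 12 < 23 = p₀`, so `p₀ − r₀q = 11 ≥ 1` and §9's thresholds exist.  Pure arithmetic (`decide`); §6/§10
check ONLY the exponent / γ-clause / rate arithmetic of §4, §5, §9 — no analytic input of print is verified here. [folklore] -/
theorem exponent_constraints_23 :
    2 * 21 - (4 + 5) * 2 > 23 ∧ 21 < 23 ∧ 2 * (4 + 2) < 23 ∧ 1 ≤ 23 - 2 * (4 + 2) := by decide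

/-- BOTH γ-CLAUSES of `credit_dominates_window_poly` at the §4.3/§4.4 witnesses `L = 13`, `β₀ = 1/7`, `p₀ = 23`,
`r₀ = 2`, `q = d + 2 = 6`, `F = 10`, `A₀ = 1`, `κ₁ = 50`, `c₁ = c₂ = 7/32` (so `c₁ + c₂ = (2(1+β₀))⁻¹ = 7/16` as in §6),
infrared value `log g_K⁻² = 254`: clause 1 with entropy margin `E₀ = 10^40` (`13·(8/7)·(550 + 10^40) ≤ (7/32)·254^21`,
≈ 1.5·10^41 vs ≈ 6.9·10^49) and clause 2 with control-cost constant `E₁ = 10^19`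
(`13^6·(8/7)·10^19 ≤ (7/32)·254^11`, ≈ 5.5·10^25 vs ≈ 6.2·10^25), and clause 2 in the window-sum form of
`credit_dominates_windowSum` (`q' = d + 1 = 5`, per-step constant `E₂ = 10^12`: `13^6·(8/7)·(11·13^5·10^12) ≤ (7/32)·254^11`,
≈ 2.3·10^25 vs ≈ 6.2·10^25).  Any smaller `E₀`, `E₁`, `E₂` a fortiori; print's constants `O(1)·3·(100M)^d`,
`O(1)(64)^dM^d` with unspecified O(1) and M are NOT claimed to be below these values — larger constants only raise the
threshold `x₀` of `exists_threshold_poly` (the «γ small enough» of p. 387). [folklore] -/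
theorem gamma_clauses_poly_13 :
    (13 : ℝ) * (1 + 1 / 7) * ((1 + 10) * 50 + 10 ^ 40) ≤ 7 / 32 * 1 * (254 : ℝ) ^ (23 - 2) ∧
      (13 : ℝ) ^ 6 * (1 + 1 / 7) * 10 ^ 19 ≤ 7 / 32 * 1 * (254 : ℝ) ^ (23 - 2 * 6) ∧
      (13 : ℝ) ^ (5 + 1) * (1 + 1 / 7) * ((1 + 10) * (13 : ℝ) ^ 5 * 10 ^ 12) ≤
        7 / 32 * 1 * (254 : ℝ) ^ (23 - 2 * (5 + 1)) := by
  refine ⟨?_, ?_, ?_⟩ <;> norm_num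

end NumbersPoly

/-! ## §11 The birth credit dominates the size-carrying costs (v1.2) -/

section Birth

/-- Along the typed (2.7) (`B14.FlowIneq27`, first member) the INFRARED profile is below every earlier one up to the
factor `(1 + β₀)`: `p0Profile A₀ p₀ (g K) ≤ (1 + β₀) · p0Profile A₀ p₀ (g s)` for `s ≤ K`. [folklore] -/
theorem p0Profile_ir_le {g : ℕ → ℝ} {β' β₀ A₀ : ℝ} {p₀ K : ℕ} (h27 : B14.FlowIneq27 g β' β₀ p₀ K)
    (hβ : 0 ≤ β₀) (hA : 0 ≤ A₀) (hxK : 0 ≤ Real.log ((g K) ^ 2)⁻¹) {s : ℕ} (hs : s ≤ K) :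
    p0Profile A₀ p₀ (g K) ≤ (1 + β₀) * p0Profile A₀ p₀ (g s) := by
  unfold p0Profile
  rcases Nat.lt_or_ge s K with hlt | hge
  · have h := (h27 s K hlt le_rfl).1
    calc A₀ * (Real.log ((g K) ^ 2)⁻¹) ^ p₀ ≤ A₀ * ((1 + β₀) * (Real.log ((g s) ^ 2)⁻¹) ^ p₀) :=
          mul_le_mul_of_nonneg_left h hA
      _ = (1 + β₀) * (A₀ * (Real.log ((g s) ^ 2)⁻¹) ^ p₀) := by ring
  · have hsK : s = K := le_antisymm hs hge
    subst hsK
    have h0 : 0 ≤ A₀ * (Real.log ((g s) ^ 2)⁻¹) ^ p₀ := mul_nonneg hA (pow_nonneg hxK _)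
    nlinarith

/-- **THE BIRTH CREDIT DOMINATES THE SIZE-CARRYING COSTS, FATNESS CLASS BY FATNESS CLASS.**  Print gives every
new component `Z_j^{(i)}` of fatness `d′ = d′_j(Z_j^{(i)})` the birth factor «exp(−½γ₀A₁²p₀²(g_j)(d′_j(Z_j^{(i)}) + 1) −
2p₀(g_j))» ((1.79) p. 383) and pays the whole window cost (1.81) out of a quarter of its quadratic part: «¼γ₀(14)^{−d}
A₁²p₀²(g₁) ≥ O(1)2(64)^dM^dL^{d+1}R₁^{d+2}. This condition is satisfied for p₀ large, and g₁ sufficiently small.»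
(p. 385).  Typed form over the abstract flow: if the size-proportional costs per unit of `d′ + 1` — a fat-shape entropy
`E_f`, a summability margin `μ`, and an R-polynomial control cost `E_b·(R s)^q` (the decayed first sum of (1.81),
`windowCostDecay_le`) — are dominated by `c₃ · p0Profile A₀ p₀ (g s)` at every `s ≤ K` (this is the conclusion
shape of `credit_dominates_window_poly` with `κ₁ := 0`, available under `r·q ≤ p₀` and a γ-clause), and the infrared
threshold `(1 + β₀)·c₃ ≤ a · p0Profile A₀ p₀ (g K)` holds, then at EVERY scale `s ≤ K` and for EVERY fatness `d′`:
`(E_f + μ + E_b (R s)^q)(d′ + 1) ≤ a · (p0Profile A₀ p₀ (g s))² · (d′ + 1)`.  (`a` stands for print's `½γ₀A₁²` or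
`¼γ₀(14)^{−d}A₁²`; `(p0Profile A₀ p₀ x)² = p0Profile A₀² (2p₀) x`.  Print's exponent need at the birth is only
`2p₀ ≥ (d+2)r₀`; routing through `credit_dominates_window_poly` uses the stronger `r·q ≤ p₀` = (X7), which the cell
assumes anyway for the renewal reset p. 386.)  That the left side IS what a birth of fatness `d′` costs, and that the
residual `exp(−μ(d′+1))` is the birth kind's price `ρ_b`, is READING (ID). [folklore] -/
theorem birthCredit_dominates {g : ℕ → ℝ} {R : ℕ → ℕ} {β' β₀ A₀ a c₃ E_f μ E_b : ℝ} {p₀ q K : ℕ}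
    (h27 : B14.FlowIneq27 g β' β₀ p₀ K) (hβ : 0 ≤ β₀) (hA : 0 ≤ A₀) (ha : 0 ≤ a)
    (hx0 : ∀ s, s ≤ K → 0 ≤ Real.log ((g s) ^ 2)⁻¹)
    (hpoly : ∀ s, s ≤ K → E_f + μ + E_b * (R s : ℝ) ^ q ≤ c₃ * p0Profile A₀ p₀ (g s))
    (hthr : (1 + β₀) * c₃ ≤ a * p0Profile A₀ p₀ (g K)) :
    ∀ s, s ≤ K → ∀ d' : ℕ,
      (E_f + μ + E_b * (R s : ℝ) ^ q) * ((d' : ℝ) + 1) ≤ a * (p0Profile A₀ p₀ (g s)) ^ 2 * ((d' : ℝ) + 1) := by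
  intro s hs d'
  have hP0 : 0 ≤ p0Profile A₀ p₀ (g s) := by
    unfold p0Profile; exact mul_nonneg hA (pow_nonneg (hx0 s hs) _)
  have hir := p0Profile_ir_le h27 hβ hA (hx0 K le_rfl) hs
  have hb : (0 : ℝ) < 1 + β₀ := by linarith
  have hc3 : c₃ ≤ a * p0Profile A₀ p₀ (g s) := by
    have h1 : (1 + β₀) * c₃ ≤ (1 + β₀) * (a * p0Profile A₀ p₀ (g s)) :=
      calc (1 + β₀) * c₃ ≤ a * p0Profile A₀ p₀ (g K) := hthr
        _ ≤ a * ((1 + β₀) * p0Profile A₀ p₀ (g s)) := mul_le_mul_of_nonneg_left hir ha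
        _ = (1 + β₀) * (a * p0Profile A₀ p₀ (g s)) := by ring
    exact le_of_mul_le_mul_left h1 hb
  have key : E_f + μ + E_b * (R s : ℝ) ^ q ≤ a * (p0Profile A₀ p₀ (g s)) ^ 2 :=
    calc E_f + μ + E_b * (R s : ℝ) ^ q ≤ c₃ * p0Profile A₀ p₀ (g s) := hpoly s hs
      _ ≤ (a * p0Profile A₀ p₀ (g s)) * p0Profile A₀ p₀ (g s) := mul_le_mul_of_nonneg_right hc3 hP0
      _ = a * (p0Profile A₀ p₀ (g s)) ^ 2 := by ring
  exact mul_le_mul_of_nonneg_right key (by positivity)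

/-- The squared profile is again a profile: `(p0Profile A₀ p₀ x)² = p0Profile (A₀²) (2p₀) x` — print's `p₀²(g_j)`
is the exponent-`2p₀` profile. [folklore] -/
theorem p0Profile_sq (A₀ : ℝ) (p₀ : ℕ) (x : ℝ) :
    (p0Profile A₀ p₀ x) ^ 2 = p0Profile (A₀ ^ 2) (2 * p₀) x := by
  unfold p0Profile; ring

/-- **SUMMABILITY OF THE FATNESS RESIDUAL** (what makes `Σ_b ρ_b ≤ ρ̄` of `slotDom_of_records` uniform in the cutoff
and the volume when birth kinds are fatness classes): for `μ > 0` and any number `D` of classes,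
`Σ_{d′ < D} exp(−μ(d′+1)) ≤ exp(−μ)/(1 − exp(−μ))`. [folklore] -/
theorem sum_exp_neg_succ_le {μ : ℝ} (hμ : 0 < μ) (D : ℕ) :
    ∑ d' ∈ Finset.range D, Real.exp (-(μ * ((d' : ℝ) + 1))) ≤ Real.exp (-μ) / (1 - Real.exp (-μ)) := by
  have ht0 : 0 ≤ Real.exp (-μ) := (Real.exp_pos _).le
  have ht1 : Real.exp (-μ) < 1 := Real.exp_lt_one_iff.2 (by linarith)
  have hterm : ∀ d' : ℕ, Real.exp (-(μ * ((d' : ℝ) + 1))) = Real.exp (-μ) * (Real.exp (-μ)) ^ d' := by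
    intro d'
    rw [← Real.exp_nat_mul, ← Real.exp_add]
    congr 1; ring
  simp_rw [hterm]
  rw [← Finset.mul_sum]
  have hgeom : ∑ d' ∈ Finset.range D, (Real.exp (-μ)) ^ d' ≤ 1 / (1 - Real.exp (-μ)) := by
    have := geom_sum_Ico_le_of_lt_one ht0 ht1 (m := 0) (n := D)
    rw [← Finset.range_eq_Ico, pow_zero] at this
    exact this
  calc Real.exp (-μ) * ∑ d' ∈ Finset.range D, (Real.exp (-μ)) ^ d'
      ≤ Real.exp (-μ) * (1 / (1 - Real.exp (-μ))) := mul_le_mul_of_nonneg_left hgeom ht0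
    _ = Real.exp (-μ) / (1 - Real.exp (-μ)) := by ring

end Birth

example : (p0Profile 1 23 (Real.exp (-(127 : ℝ)))) ^ 2 = p0Profile (1 ^ 2) (2 * 23) (Real.exp (-(127 : ℝ))) :=
  p0Profile_sq 1 23 _

/-! ## §12 The all-ages context count diverges with the cutoff (v1.4): births alone never pay the cell entropy

Necessity side of the bookkeeping, complementary to §9 (`credit_dominates_window`: WITHIN one window the credit pays) and to
the persistence count of §§3–6 (renewal credit linear in the age).  The only printed input is the second member of (2.7)
(`B14.FlowIneq27`, hypothesis `h27` as in §9); `V`, `Λ`, `C`, `c`, `β₀` are symbols; nothing of Bałaban's is asserted. -/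

section AllAges

open Filter

/-- (2.7), second member, read ALONG AGES from the final step: the birth credit of a component born `a` steps before
the final step `K` exceeds the final one by at most the factor `(1 + g_K² β′ a)^{β₀}` — a POWER `β₀` of the age, not an
exponential. [cite: Balaban1988Convergent, (2.7) p.255] -/
theorem p0Profile_age_le {g : ℕ → ℝ} {β' β₀ A₀ : ℝ} {p₀ K : ℕ} (h27 : B14.FlowIneq27 g β' β₀ p₀ K)
    (hA : 0 ≤ A₀) {a : ℕ} (ha : a ≤ K) :
    p0Profile A₀ p₀ (g (K - a)) ≤ (1 + (g K) ^ 2 * β' * a) ^ β₀ * p0Profile A₀ p₀ (g K) := by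
  rcases Nat.eq_zero_or_pos a with rfl | hapos
  · simp [p0Profile]
  · have hmn : K - a < K := Nat.sub_lt (lt_of_lt_of_le hapos ha) hapos
    have h := (h27 (K - a) K hmn le_rfl).2
    have hcast : ((K : ℝ) - ((K - a : ℕ) : ℝ)) = a := by
      rw [Nat.cast_sub ha]; ring
    rw [hcast] at h
    unfold p0Profile
    calc A₀ * Real.log (g (K - a) ^ 2)⁻¹ ^ p₀
        ≤ A₀ * ((1 + g K ^ 2 * β' * a) ^ β₀ * Real.log (g K ^ 2)⁻¹ ^ p₀) := mul_le_mul_of_nonneg_left h hA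
      _ = (1 + g K ^ 2 * β' * a) ^ β₀ * (A₀ * Real.log (g K ^ 2)⁻¹ ^ p₀) := by ring

/-- Elementary growth fact: an exponential in the age beats `exp` of any power `β₀ < 1` of the age —
`Λ^a · e^{−C (1 + c a)^{β₀}} → ∞`. [folklore] -/
theorem pow_mul_exp_neg_rpow_tendsto_atTop {Λ C c β₀ : ℝ} (hΛ : 1 < Λ) (hC : 0 ≤ C) (hc : 0 ≤ c)
    (hβ₀ : 0 ≤ β₀) (hβ₁ : β₀ < 1) :
    Tendsto (fun a : ℕ => Λ ^ a * Real.exp (-(C * (1 + c * a) ^ β₀))) atTop atTop := by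
  have hΛ0 : 0 < Λ := lt_trans zero_lt_one hΛ
  set ℓ : ℝ := Real.log Λ with hℓ
  have hℓ0 : 0 < ℓ := Real.log_pos hΛ
  set D : ℝ := C * (1 + c) ^ β₀ with hD
  have hD0 : 0 ≤ D := mul_nonneg hC (Real.rpow_nonneg (by linarith) _)
  -- a^{β₀ - 1} → 0 along ℕ
  have h0 : Tendsto (fun a : ℕ => ((a : ℝ)) ^ (-(1 - β₀))) atTop (nhds 0) :=
    (tendsto_rpow_neg_atTop (by linarith : 0 < 1 - β₀)).comp tendsto_natCast_atTop_atTop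
  have hε : 0 < ℓ / (2 * (D + 1)) := by positivity
  have hev : ∀ᶠ a : ℕ in atTop, ((a : ℝ)) ^ (-(1 - β₀)) < ℓ / (2 * (D + 1)) :=
    h0.eventually (gt_mem_nhds hε)
  have hev1 : ∀ᶠ a : ℕ in atTop, 1 ≤ a := eventually_ge_atTop 1
  -- the comparison exp(ℓ a / 2) ≤ term, eventually
  have hcmp : ∀ᶠ a : ℕ in atTop, Real.exp (ℓ / 2 * a) ≤ Λ ^ a * Real.exp (-(C * (1 + c * a) ^ β₀)) := by
    filter_upwards [hev, hev1] with a ha ha1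
    have ha0 : (0 : ℝ) < a := by exact_mod_cast ha1
    have hpow : Λ ^ a = Real.exp (ℓ * a) := by
      rw [← Real.rpow_natCast, Real.rpow_def_of_pos hΛ0, hℓ]
    -- C (1 + c a)^β₀ ≤ D · a^β₀
    have ha1' : (1 : ℝ) ≤ a := by exact_mod_cast ha1
    have h1 : (1 + c * a : ℝ) ≤ (1 + c) * a := by nlinarith
    have h2 : C * (1 + c * (a : ℝ)) ^ β₀ ≤ D * (a : ℝ) ^ β₀ := by
      have : (1 + c * (a : ℝ)) ^ β₀ ≤ ((1 + c) * a) ^ β₀ :=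
        Real.rpow_le_rpow (by positivity) h1 hβ₀
      rw [Real.mul_rpow (by linarith) ha0.le] at this
      calc C * (1 + c * (a : ℝ)) ^ β₀ ≤ C * ((1 + c) ^ β₀ * (a : ℝ) ^ β₀) := mul_le_mul_of_nonneg_left this hC
        _ = D * (a : ℝ) ^ β₀ := by rw [hD]; ring
    -- a^β₀ = a · a^{-(1-β₀)} and the eventual smallness
    have h3 : (a : ℝ) ^ β₀ = a * (a : ℝ) ^ (-(1 - β₀)) := by
      rw [show β₀ = 1 + (-(1 - β₀)) by ring, Real.rpow_add ha0, Real.rpow_one]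
      ring_nf
    have h4 : D * (a : ℝ) ^ β₀ ≤ ℓ / 2 * a := by
      rw [h3]
      have : D * (a : ℝ) ^ (-(1 - β₀)) ≤ ℓ / 2 := by
        calc D * (a : ℝ) ^ (-(1 - β₀)) ≤ D * (ℓ / (2 * (D + 1))) :=
              mul_le_mul_of_nonneg_left ha.le hD0
          _ = ℓ / 2 * (D / (D + 1)) := by field_simp
          _ ≤ ℓ / 2 * 1 := by
              apply mul_le_mul_of_nonneg_left _ (by positivity)
              rw [div_le_one (by positivity)]; linarith
          _ = ℓ / 2 := by ring
      calc D * (a * (a : ℝ) ^ (-(1 - β₀))) = a * (D * (a : ℝ) ^ (-(1 - β₀))) := by ring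
        _ ≤ a * (ℓ / 2) := mul_le_mul_of_nonneg_left this ha0.le
        _ = ℓ / 2 * a := by ring
    rw [hpow, ← Real.exp_add]
    apply Real.exp_le_exp.2
    linarith
  have hg : Tendsto (fun a : ℕ => Real.exp (ℓ / 2 * a)) atTop atTop :=
    Real.tendsto_exp_atTop.comp (tendsto_natCast_atTop_atTop.const_mul_atTop (by positivity))
  exact tendsto_atTop_mono' atTop hcmp hg

/-- **THE ALL-AGES CONTEXT COUNT DIVERGES WITH THE CUTOFF** (necessity side of the node's bookkeeping; [analysis +
folklore], nothing of Bałaban's asserted).  If every age class `a ≤ K` offers at least `V·Λ^a` cells (`V > 0`, `Λ > 1`: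
the torus cell count, `Λ = L^d`) and a component born at age `a` is suppressed ONLY by its birth factor `e^{−P K a}` with a
credit of (2.7)-growth `P K a ≤ C (1 + c a)^{β₀}`, `β₀ < 1` (`p0Profile_age_le` under a coupling window), then the
birth-only budget over ALL ages `Σ_{a ≤ K} V Λ^a e^{−P K a}` is UNBOUNDED in `K`.  Reading: births alone never pay the
cell entropy across all scales; the K-uniform young budgets of this package run over a BOUNDED age band (the live
window; `T4BadClassBooking.AgeCover`, `credit_dominates_window`), and summability comes from PERSISTENCE (renewal credit
linear in the age, `slotDom_of_records`). [folklore] -/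
theorem allAges_birthBudget_unbounded {V Λ C c β₀ : ℝ} {P : ℕ → ℕ → ℝ} (hV : 0 < V) (hΛ : 1 < Λ) (hC : 0 ≤ C)
    (hc : 0 ≤ c) (hβ₀ : 0 ≤ β₀) (hβ₁ : β₀ < 1) (hP : ∀ K a, a ≤ K → P K a ≤ C * (1 + c * a) ^ β₀) :
    Tendsto (fun K : ℕ => ∑ a ∈ Finset.range (K + 1), V * Λ ^ a * Real.exp (-(P K a))) atTop atTop := by
  have hΛ0 : 0 < Λ := lt_trans zero_lt_one hΛ
  have hlast : ∀ K : ℕ, V * (Λ ^ K * Real.exp (-(C * (1 + c * K) ^ β₀))) ≤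
      ∑ a ∈ Finset.range (K + 1), V * Λ ^ a * Real.exp (-(P K a)) := by
    intro K
    have hmem : K ∈ Finset.range (K + 1) := Finset.mem_range.2 (Nat.lt_succ_self K)
    have hnn : ∀ a ∈ Finset.range (K + 1), 0 ≤ V * Λ ^ a * Real.exp (-(P K a)) :=
      fun a _ => mul_nonneg (mul_nonneg hV.le (pow_nonneg hΛ0.le _)) (Real.exp_pos _).le
    calc V * (Λ ^ K * Real.exp (-(C * (1 + c * K) ^ β₀)))
        ≤ V * Λ ^ K * Real.exp (-(P K K)) := by
          rw [← mul_assoc]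
          apply mul_le_mul_of_nonneg_left _ (mul_nonneg hV.le (pow_nonneg hΛ0.le _))
          exact Real.exp_le_exp.2 (by linarith [hP K K le_rfl])
      _ ≤ ∑ a ∈ Finset.range (K + 1), V * Λ ^ a * Real.exp (-(P K a)) :=
          Finset.single_le_sum hnn hmem
  have hg : Tendsto (fun K : ℕ => V * (Λ ^ K * Real.exp (-(C * (1 + c * K) ^ β₀)))) atTop atTop :=
    (pow_mul_exp_neg_rpow_tendsto_atTop hΛ hC hc hβ₀ hβ₁).const_mul_atTop hV
  exact tendsto_atTop_mono hlast hg

/-- The (2.7)-shape hypothesis of `allAges_birthBudget_unbounded` from the typed flow inequality and a coupling window at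
the final step (`g_K² β′ ≤ c`, `p₀(g_K) ≤ C` — U5a's compact window, cell reading): for the run ending at `K`,
`P K a := p₀(g_{K−a}) ≤ C (1 + c a)^{β₀}`. [cite: Balaban1988Convergent, (2.7) p.255] -/
theorem birthCredit_flowShape {g : ℕ → ℝ} {β' β₀ A₀ C c : ℝ} {p₀ K : ℕ} (h27 : B14.FlowIneq27 g β' β₀ p₀ K)
    (hA : 0 ≤ A₀) (hβ' : 0 ≤ β') (hβ₀ : 0 ≤ β₀) (hgc : (g K) ^ 2 * β' ≤ c) (hC : p0Profile A₀ p₀ (g K) ≤ C)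
    (hP0 : 0 ≤ p0Profile A₀ p₀ (g K)) {a : ℕ} (ha : a ≤ K) :
    p0Profile A₀ p₀ (g (K - a)) ≤ C * (1 + c * a) ^ β₀ := by
  have h := p0Profile_age_le h27 hA ha
  have hc0 : 0 ≤ c := le_trans (by positivity) hgc
  have hbase : (1 + (g K) ^ 2 * β' * a : ℝ) ≤ 1 + c * a := by
    have : (g K) ^ 2 * β' * (a : ℝ) ≤ c * a := mul_le_mul_of_nonneg_right hgc (Nat.cast_nonneg a)
    linarith
  have hb0 : (0 : ℝ) ≤ 1 + (g K) ^ 2 * β' * a := by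
    have : 0 ≤ (g K) ^ 2 * β' * (a : ℝ) := by positivity
    linarith
  have hr : (1 + (g K) ^ 2 * β' * a : ℝ) ^ β₀ ≤ (1 + c * a) ^ β₀ := Real.rpow_le_rpow hb0 hbase hβ₀
  calc p0Profile A₀ p₀ (g (K - a)) ≤ (1 + (g K) ^ 2 * β' * a) ^ β₀ * p0Profile A₀ p₀ (g K) := h
    _ ≤ (1 + c * a) ^ β₀ * C := mul_le_mul hr hC hP0 (Real.rpow_nonneg (by positivity) _)
    _ = C * (1 + c * a) ^ β₀ := by ring

end AllAges

/-- Sanity (v1.4): with no age growth at all (`c = 0`) the statement is the bare fact `V·Λ^K·e^{−C} → ∞`; and the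
(2.7)-shape at `a = 0` is the trivial bound. [folklore] -/
example {V Λ C : ℝ} (hV : 0 < V) (hΛ : 1 < Λ) (hC : 0 ≤ C) :
    Filter.Tendsto (fun K : ℕ => ∑ a ∈ Finset.range (K + 1), V * Λ ^ a * Real.exp (-(fun _ _ => C) K a))
      Filter.atTop Filter.atTop :=
  allAges_birthBudget_unbounded (β₀ := 1 / 2) (c := 0) hV hΛ hC le_rfl (by norm_num) (by norm_num)
    (fun K a _ => by simp [Real.one_rpow])

end Literature.MathematicalPhysics.QuantumFieldTheory.Balaban1983to89.T4PersistentHistoryCount
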